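import Mathlib.Analysis.SpecialFunctions.Integrability.Basic
import Literature.Analysis.FluidPDE.RusinSverakSingularTimeHolds
import Literature.Analysis.FluidPDE.NSLerayHopfSereginEnergyProofs
import Literature.Analysis.FluidPDE.LerayHopfClassicalContinuation
import Literature.Analysis.FluidPDE.LerayLocalRegularH1Proofs
import Literature.Analysis.FluidPDE.NSLerayExistenceR3Holds
import Literature.Analysis.FluidPDE.NSCriticalClosureTao
import Literature.Analysis.FluidPDE.TaoClassGlobal
import Literature.Analysis.FluidPDE.WeakSolutionWeakContinuity
import Literature.Barriers.NavierStokesRegularity.AveragedTypeIBlowup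
import Literature.Analysis.FluidPDE.TaoAveragedComplexAverageReal
import Literature.Analysis.FluidPDE.TaoCascadeDuhamel
import Mathlib.Analysis.InnerProductSpace.Dual
import Literature.Analysis.FluidPDE.NSUnconditionalUniquenessHolds
import Literature.Analysis.FluidPDE.TaoAveragedFibreIdentity
import Literature.Analysis.FluidPDE.NSCriticalClosureBesovKatoClass
import Literature.Analysis.FluidPDE.KNSSTypeIIHolds
import Mathlib.Analysis.Fourier.FourierTransformDeriv
import Literature.Analysis.FluidPDE.TaoAveragedEulerLerayL2
import Mathlib.Analysis.Fourier.LpSpace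
import Mathlib.Algebra.Order.Chebyshev
import Mathlib.Analysis.Calculus.LineDeriv.IntegrationByParts
import Mathlib.Analysis.Distribution.AEEqOfIntegralContDiff
import Mathlib.MeasureTheory.Integral.Prod
import Literature.Analysis.FluidPDE.NSLerayBlowupRateTopHolds
import Mathlib.Analysis.SpecialFunctions.Pow.Real
import Literature.Analysis.FluidPDE.VectorCalculusProofs
import Mathlib.Analysis.SpecialFunctions.Pow.Deriv
import Literature.Analysis.FluidPDE.NSVorticityBKMContinuation
import Literature.Analysis.FluidPDE.VorticityFormulationHolds
import Literature.Analysis.FluidPDE.ConstantinDirectionDissipationCalculus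
import Literature.Analysis.FluidPDE.LambFormCurlKernel
import Mathlib.MeasureTheory.Integral.MeanInequalities
import Mathlib.Analysis.Convex.SpecificFunctions.Basic
import Literature.Analysis.FluidPDE.NavierStokesClassicalIsH10Mild
import Literature.Analysis.FluidPDE.FluidComputer.CascadeWitness
import HarnessLib

/-!
# Tao's `H¹⁰_df` mild Navier–Stokes solutions, file 3 of 3: uniqueness of `H¹⁰_df`-mild solutions and the blow-up dictionary — `FluidComputer.MildMaximalGivesBlowup` HOLDS (re-homed proofs)

**T. Tao, *Finite time blowup for an averaged three-dimensional Navier–Stokes equation*, J. Amer. Math. Soc. 29 (2016), §1.1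
[Tao2016AveragedNS]: the `H¹⁰_df` mild formulation ((1.3)–(1.5), (1.15)) of the Navier–Stokes equation and its dictionary with
classical solutions.**  The named fact `Literature.Analysis.FluidPDE.FluidComputer.MildMaximalGivesBlowup`
(`FluidComputer/CascadeWitness.lean`: an `H¹⁰_df`-mild solution of the true equation from a Schwartz divergence-free datum on
`[0,S)` with no mild extension past `S` yields a maximal smooth solution with finite lifespan, Leray–Hopf from its rapidly
decaying datum) is PROVED in the tree by the Navier–Stokes perpetual-pump cell (a classical Tao-class solution is `H¹⁰_df`-mild —
Fourier-side Sobolev calculus on `ℝ³`, the trilinear form, the heat pairing and the tested Duhamel identity, `H¹⁰` membership and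
continuity; uniqueness of `H¹⁰_df`-mild solutions through the weighted bilinear Duhamel operator; and the blow-up dictionary: no
global Kato solution, the Kato maximal time, gluing of Tao-class solutions, Leray–Hopf by weak–strong comparison, maximality by
the singular point) — until now Summits-side only (`Summits/NavierStokesRegularity/NavierStokesRegularity/Theorems/FluidComputerCascade.lean`,
`mildMaximalGivesBlowup_holds := pumpContinuation_mildBlowupClassical_proof`).  RE-HOMED into `Literature/` by the Hodge foundations
lane (`lit-hodgefound`, prover p20, generation 39) as THREE files: verbatim DECLARATION-LEVEL ports (the 187 declarations the
discharge needs, in dependency order; each Part header lists the declarations of its source module that are NOT carried) of 24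
Summits modules `Summits/NavierStokesRegularity/NavierStokesRegularity/Theorems/{PerpetualPumpEulerTypeIGlue*,PerpetualPumpThesis*,PumpContinuationMildBlowupClassical}.lean`,
namespaces `Summit.NavierStokesRegularity.NavierStokesRegularity.Theorems{,.…}` re-rooted to `Literature.Analysis.PerpetualPump{,.…}`
(a root outside `Literature.Analysis.FluidPDE` on purpose: namespace-prefix resolution would otherwise shadow the cone's lemmas by
same-named `FluidPDE` lemmas); the three `local notation`s of the sources (`ℝ³`, `ℂ³`, `𝐞ᵤ i`) are expanded textually; imports
from `Literature/` and Mathlib only; no `sorry`, no new axiom, NO named fact (D-0026).  ONE deliberate deviation: the source states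
`pumpContinuation_mildBlowupClassical_proof : Theses.PumpContinuation.MildBlowupClassical` (a Summits route Prop, by the fact's own
docstring VERBATIM the same statement); here its type is written as the Literature fact `FluidComputer.MildMaximalGivesBlowup`
itself (identical binders, identical proof script).  PROVENANCE CONVENTION: docstrings are carried byte-for-byte; declarations the
cell cites keep their cites; `[folklore]`-tagged and untagged declarations (the cell's own lemmas) carry the Part's tag
`[cite: <Key>, <loc> (source of the NOTION / ARGUMENT this module implements; this declaration is the cell's own lemma or plumbing,
NOT a printed statement)]`, because the gate does not admit a public Literature theorem without a cite tag.

THIS FILE (3 of 3) ports: PerpetualPumpThesisUniquenessContinuity, PerpetualPumpThesisLocalExistenceOps, PerpetualPumpThesisLocalExistenceDuhamel, PerpetualPumpThesisLocalExistenceStep, PerpetualPumpThesisUniqueness, PumpContinuationMildBlowupClassical.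
-/

noncomputable section

/-!
## Part 1 — port of `Summits/NavierStokesRegularity/NavierStokesRegularity/Theorems/PerpetualPumpThesisUniquenessContinuity.lean` (6 declarations kept)

# Stub U (`uniqueness`) for `PerpetualPump.Thesis`, part II: the Duhamel integrand of the averaged
# mild formulation is continuous in time

Support file (part 2 of the stub `uniqueness` of line `SketchIdeator2`, crux
stmt-NavierStokesRegularity-1832). In Tao's mild formulation (J. Amer. Math. Soc. 29 (2016),
arXiv:1402.0290v3, §1.1 (1.15)) of the averaged equation `∂ₜu = Δu + B̃(u,u)` the Duhamel term is
the time integral `∫₀ᵗ ⟨B̃(u(s),u(s)), e^{(t-s)Δ} w⟩ ds`, rendered in the tree as an interval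
(Bochner) integral, so every manipulation of it (splitting, subtracting two solutions) needs the
integrand to be integrable. This file proves, for an *arbitrary* averaging datum `𝒜`:

* differences of the trilinear form `𝒜.form = ⟨B̃(·,·), ·⟩` in each slot on fields of finite `H¹⁰`
  norm (`form_sub₁`, `form_sub₂`, `form_sub₃`) and the splitting
  `⟨B̃(x,x), h⟩ - ⟨B̃(y,y), h⟩ = ⟨B̃(x-y,x), h⟩ + ⟨B̃(y,x-y), h⟩` (`form_sub_form`), from the
  trilinearity of part III of stub B;
* the real-valued tame bound `|⟨B̃(u,v), w⟩| ≤ K ‖u‖_{H¹⁰} ‖v‖_{H¹⁰} ‖w‖_{L²}` (`norm_form_le_real`);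
* **continuity of `s ↦ ⟨B̃(v(s),v(s)), e^{(t-s)Δ} w⟩`** on any time set on which `v` is
  `H¹⁰`-continuous and `H¹⁰`-bounded (`continuousOn_form_heat`, registered sub-goal
  `stub_uniqueness_Continuity`), hence interval integrability on compact sub-intervals
  (`intervalIntegrable_form_heat`) — the averaged analogue of the tree's
  `continuousOn_eulerForm_heat` (same three-term splitting, with the strong continuity of `e^{τΔ}`
  on `L²`).

## References

* T. Tao, J. Amer. Math. Soc. 29 (2016), 601–674, arXiv:1402.0290v3, §1.1 (1.12)–(1.15), p. 7.

Not carried from this source module (not needed by the declarations re-homed here; their consumers are Summits-side): `intervalIntegrable_form_heat`, `stub_uniqueness_Continuity`.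
-/

section Part1

open _root_.MeasureTheory _root_.Set _root_.Filter _root_.Topology
open scoped _root_.ENNReal _root_.NNReal

namespace Literature.Analysis.PerpetualPump.PerpetualPumpThesis.U

open Literature.Analysis.FluidPDE Literature.Analysis.FluidPDE.Tao2016
open Literature.Analysis.FunctionSpaces (eFourierSobolevNorm)
open Literature.Analysis.PerpetualPump.PerpetualPumpEulerTypeIGlue
  (continuous_heat_apply norm_heat_le eFourierSobolevNorm_sub_lt_top)

/-! ### Differences of the averaged form -/

/-- `⟨B̃(x,v), h⟩ - ⟨B̃(x',v), h⟩ = ⟨B̃(x - x',v), h⟩` on fields of finite `H¹⁰` norm.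
[cite: Tao2016AveragedNS, §1.1 (1.15) p. 7 (local well-posedness of `H¹⁰_df` mild solutions: the bilinear Duhamel operator, uniqueness) (source of the NOTION / ARGUMENT this module implements; this declaration is the cell’s own lemma or plumbing, NOT a printed statement)] -/
theorem form_sub₁ (𝒜 : AveragingDatum) {x x' v : L2C} (h : L2C) (hx : eFourierSobolevNorm 10 x < ⊤)
    (hx' : eFourierSobolevNorm 10 x' < ⊤) (hv : eFourierSobolevNorm 10 v < ⊤) :
    𝒜.form x v h - 𝒜.form x' v h = 𝒜.form (x - x') v h := by
  have hxx' : eFourierSobolevNorm 10 (x - x') < ⊤ := eFourierSobolevNorm_sub_lt_top hx hx'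
  have h1 := B.form_add₁ 𝒜 h hxx' hx' hv
  rw [sub_add_cancel] at h1
  rw [h1, add_sub_cancel_right]

/-- `⟨B̃(u,y), h⟩ - ⟨B̃(u,y'), h⟩ = ⟨B̃(u,y - y'), h⟩` on fields of finite `H¹⁰` norm.
[cite: Tao2016AveragedNS, §1.1 (1.15) p. 7 (local well-posedness of `H¹⁰_df` mild solutions: the bilinear Duhamel operator, uniqueness) (source of the NOTION / ARGUMENT this module implements; this declaration is the cell’s own lemma or plumbing, NOT a printed statement)] -/
theorem form_sub₂ (𝒜 : AveragingDatum) {u y y' : L2C} (h : L2C) (hu : eFourierSobolevNorm 10 u < ⊤)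
    (hy : eFourierSobolevNorm 10 y < ⊤) (hy' : eFourierSobolevNorm 10 y' < ⊤) :
    𝒜.form u y h - 𝒜.form u y' h = 𝒜.form u (y - y') h := by
  have hyy' : eFourierSobolevNorm 10 (y - y') < ⊤ := eFourierSobolevNorm_sub_lt_top hy hy'
  have h1 := B.form_add₂ 𝒜 h hu hyy' hy'
  rw [sub_add_cancel] at h1
  rw [h1, add_sub_cancel_right]

/-- `⟨B̃(u,v), z⟩ - ⟨B̃(u,v), z'⟩ = ⟨B̃(u,v), z - z'⟩` for `u, v` of finite `H¹⁰` norm.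
[cite: Tao2016AveragedNS, §1.1 (1.15) p. 7 (local well-posedness of `H¹⁰_df` mild solutions: the bilinear Duhamel operator, uniqueness) (source of the NOTION / ARGUMENT this module implements; this declaration is the cell’s own lemma or plumbing, NOT a printed statement)] -/
theorem form_sub₃ (𝒜 : AveragingDatum) {u v : L2C} (z z' : L2C) (hu : eFourierSobolevNorm 10 u < ⊤)
    (hv : eFourierSobolevNorm 10 v < ⊤) :
    𝒜.form u v z - 𝒜.form u v z' = 𝒜.form u v (z - z') := by
  have h1 := B.form_add₃ 𝒜 (z - z') z' hu hv
  rw [sub_add_cancel] at h1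
  rw [h1, add_sub_cancel_right]

/-- **The splitting of the difference of two quadratic terms**:
`⟨B̃(x,x), h⟩ - ⟨B̃(y,y), h⟩ = ⟨B̃(x-y,x), h⟩ + ⟨B̃(y,x-y), h⟩` on fields of finite `H¹⁰` norm
(the identity behind the energy estimate for the difference of two mild solutions).
[cite: Tao2016AveragedNS, §1.1 (1.15) p. 7 (local well-posedness of `H¹⁰_df` mild solutions: the bilinear Duhamel operator, uniqueness) (source of the NOTION / ARGUMENT this module implements; this declaration is the cell’s own lemma or plumbing, NOT a printed statement)] -/
theorem form_sub_form (𝒜 : AveragingDatum) {x y : L2C} (h : L2C) (hx : eFourierSobolevNorm 10 x < ⊤)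
    (hy : eFourierSobolevNorm 10 y < ⊤) :
    𝒜.form x x h - 𝒜.form y y h = 𝒜.form (x - y) x h + 𝒜.form y (x - y) h := by
  rw [← form_sub₁ 𝒜 h hx hy hx, ← form_sub₂ 𝒜 h hy hx hy]
  ring

/-! ### The real-valued tame bound -/

/-- **Real-valued tame bound**: `|⟨B̃(u,v), w⟩| ≤ K ‖u‖_{H¹⁰} ‖v‖_{H¹⁰} ‖w‖_{L²}` for `u, v` of finite
`H¹⁰` norm, given the `H¹⁰ × H¹⁰ × H⁻⁹` bound of stub B with constant `K`.
[cite: Tao2016AveragedNS, §1.1 (1.15) p. 7 (local well-posedness of `H¹⁰_df` mild solutions: the bilinear Duhamel operator, uniqueness) (source of the NOTION / ARGUMENT this module implements; this declaration is the cell’s own lemma or plumbing, NOT a printed statement)] -/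
theorem norm_form_le_real (𝒜 : AveragingDatum) {K9 : ℝ≥0}
    (hK9 : ∀ u v w : L2C, eFourierSobolevNorm 10 u < ⊤ → eFourierSobolevNorm 10 v < ⊤ →
      ‖𝒜.form u v w‖ₑ ≤ (K9 : ℝ≥0∞) * eFourierSobolevNorm 10 u * eFourierSobolevNorm 10 v *
        eFourierSobolevNorm (-9) w)
    {u v : L2C} (hu : eFourierSobolevNorm 10 u < ⊤) (hv : eFourierSobolevNorm 10 v < ⊤) (w : L2C) :
    ‖𝒜.form u v w‖ ≤ (K9 : ℝ) * (eFourierSobolevNorm 10 u).toReal * (eFourierSobolevNorm 10 v).toReal *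
      ‖w‖ := by
  have h := B.norm_form_le 𝒜 hK9 hu hv w
  rwa [ENNReal.toReal_mul, ENNReal.toReal_mul, ENNReal.coe_toReal] at h

/-! ### Continuity of the Duhamel integrand -/

/-- **The Duhamel integrand `s ↦ ⟨B̃(v(s),v(s)), e^{(t-s)Δ} w⟩` is continuous** on a time set on
which `v` is `H¹⁰`-continuous with `H¹⁰` norms bounded by `M`, for every averaging datum (Tao
2016, p. 7: the averaged form converges absolutely on `H¹⁰ × H¹⁰ × L²`; plus the strong
continuity of `e^{τΔ}` on `L²`).
[cite: Tao2016AveragedNS, §1.1 (1.15) p. 7 (local well-posedness of `H¹⁰_df` mild solutions: the bilinear Duhamel operator, uniqueness) (source of the NOTION / ARGUMENT this module implements; this declaration is the cell’s own lemma or plumbing, NOT a printed statement)] -/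
theorem continuousOn_form_heat (𝒜 : AveragingDatum) {I : Set ℝ} {v : ℝ → L2C}
    (hv : ContinuousInH10On I v) {M : ℝ} (hM : ∀ s ∈ I, eFourierSobolevNorm 10 (v s) ≤ ENNReal.ofReal M)
    (w : L2C) (t : ℝ) :
    ContinuousOn (fun s => 𝒜.form (v s) (v s) (heat (t - s) w)) I := by
  obtain ⟨K9, hK9⟩ := B.exists_enorm_form_le 𝒜
  set K : ℝ := (K9 : ℝ) with hK
  have hK0 : 0 ≤ K := K9.coe_nonneg
  have hfin : ∀ s ∈ I, eFourierSobolevNorm 10 (v s) < ⊤ := fun s hs =>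
    lt_of_le_of_lt (hM s hs) ENNReal.ofReal_lt_top
  have hreal : ∀ s ∈ I, (eFourierSobolevNorm 10 (v s)).toReal ≤ max M 0 := fun s hs => by
    have := ENNReal.toReal_mono ENNReal.ofReal_ne_top (hM s hs)
    refine this.trans ?_
    by_cases h : 0 ≤ M
    · rw [ENNReal.toReal_ofReal h]; exact le_max_left _ _
    · rw [ENNReal.ofReal_of_nonpos (not_le.1 h).le, ENNReal.toReal_zero]; exact le_max_right _ _
  intro s₀ hs₀
  rw [ContinuousWithinAt, tendsto_iff_norm_sub_tendsto_zero]
  set M' : ℝ := max M 0 with hM'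
  have hM'0 : 0 ≤ M' := le_max_right _ _
  -- the three-term decomposition and its bound
  have hbound : ∀ s ∈ I, ‖𝒜.form (v s) (v s) (heat (t - s) w) - 𝒜.form (v s₀) (v s₀) (heat (t - s₀) w)‖ ≤
      K * (eFourierSobolevNorm 10 (v s - v s₀)).toReal * M' * ‖w‖ +
      K * M' * (eFourierSobolevNorm 10 (v s - v s₀)).toReal * ‖w‖ +
      K * M' * M' * ‖heat (t - s) w - heat (t - s₀) w‖ := by
    intro s hs
    have e1 := form_sub_form 𝒜 (heat (t - s) w) (hfin s hs) (hfin s₀ hs₀)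
    have e3 := form_sub₃ 𝒜 (heat (t - s) w) (heat (t - s₀) w) (hfin s₀ hs₀) (hfin s₀ hs₀)
    have hdec : 𝒜.form (v s) (v s) (heat (t - s) w) - 𝒜.form (v s₀) (v s₀) (heat (t - s₀) w) =
        𝒜.form (v s - v s₀) (v s) (heat (t - s) w) + 𝒜.form (v s₀) (v s - v s₀) (heat (t - s) w) +
          𝒜.form (v s₀) (v s₀) (heat (t - s) w - heat (t - s₀) w) := by
      rw [← e1, ← e3]; ring
    rw [hdec]
    have hsub := eFourierSobolevNorm_sub_lt_top (hfin s hs) (hfin s₀ hs₀)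
    refine (norm_add₃_le).trans (add_le_add_three ?_ ?_ ?_)
    · refine (norm_form_le_real 𝒜 hK9 hsub (hfin s hs) _).trans ?_
      have h1 := hreal s hs
      have h2 := norm_heat_le (t - s) w
      gcongr
    · refine (norm_form_le_real 𝒜 hK9 (hfin s₀ hs₀) hsub _).trans ?_
      have h1 := hreal s₀ hs₀
      have h2 := norm_heat_le (t - s) w
      gcongr
    · refine (norm_form_le_real 𝒜 hK9 (hfin s₀ hs₀) (hfin s₀ hs₀) _).trans ?_
      have h1 := hreal s₀ hs₀
      gcongr
  -- the two vanishing quantities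
  have hH10 : Tendsto (fun s => (eFourierSobolevNorm 10 (v s - v s₀)).toReal) (𝓝[I] s₀) (𝓝 0) := by
    have h := (ENNReal.tendsto_toReal ENNReal.zero_ne_top).comp (hv s₀ hs₀)
    rw [ENNReal.toReal_zero] at h
    exact h.congr fun s => rfl
  have hheat : Tendsto (fun s => ‖heat (t - s) w - heat (t - s₀) w‖) (𝓝[I] s₀) (𝓝 0) := by
    have hc : Continuous fun s : ℝ => heat (t - s) w :=
      (continuous_heat_apply w).comp (continuous_const.sub continuous_id)
    have := ((hc.tendsto s₀).sub_const (heat (t - s₀) w)).norm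
    simp only [sub_self, norm_zero] at this
    exact this.mono_left nhdsWithin_le_nhds
  have hrhs : Tendsto (fun s => K * (eFourierSobolevNorm 10 (v s - v s₀)).toReal * M' * ‖w‖ +
      K * M' * (eFourierSobolevNorm 10 (v s - v s₀)).toReal * ‖w‖ +
      K * M' * M' * ‖heat (t - s) w - heat (t - s₀) w‖) (𝓝[I] s₀) (𝓝 0) := by
    have h1 : Tendsto (fun s => K * (eFourierSobolevNorm 10 (v s - v s₀)).toReal * M' * ‖w‖) (𝓝[I] s₀)
        (𝓝 (K * 0 * M' * ‖w‖)) := ((hH10.const_mul K).mul_const M').mul_const ‖w‖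
    have h2 : Tendsto (fun s => K * M' * (eFourierSobolevNorm 10 (v s - v s₀)).toReal * ‖w‖) (𝓝[I] s₀)
        (𝓝 (K * M' * 0 * ‖w‖)) := (hH10.const_mul (K * M')).mul_const ‖w‖
    have h3 : Tendsto (fun s => K * M' * M' * ‖heat (t - s) w - heat (t - s₀) w‖) (𝓝[I] s₀)
        (𝓝 (K * M' * M' * 0)) := hheat.const_mul (K * M' * M')
    simpa using (h1.add h2).add h3
  refine squeeze_zero_norm' ?_ hrhs
  filter_upwards [self_mem_nhdsWithin] with s hs
  rw [norm_norm]
  exact hbound s hs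

end Literature.Analysis.PerpetualPump.PerpetualPumpThesis.U

namespace Literature.Analysis.PerpetualPump.PerpetualPumpThesis

open Literature.Analysis.FluidPDE Literature.Analysis.FluidPDE.Tao2016
open Literature.Analysis.FunctionSpaces (eFourierSobolevNorm)

end Literature.Analysis.PerpetualPump.PerpetualPumpThesis

end Part1

/-!
## Part 2 — port of `Summits/NavierStokesRegularity/NavierStokesRegularity/Theorems/PerpetualPumpThesisLocalExistenceOps.lean` (2 declarations kept)

# Stub E (`localExistence`) for `PerpetualPump.Thesis`, part I: the operator toolkit of the
# lifted Picard iteration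

Support file (part 1 of the stub `localExistence` of line `SketchIdeator2`, crux
stmt-NavierStokesRegularity-1832). The local existence theory for Tao's averaged Navier–Stokes
equation `∂ₜu = Δu + B̃(u,u)` in `C([0,τ]; H¹⁰_df(ℝ³))` (T. Tao, J. Amer. Math. Soc. 29 (2016),
arXiv:1402.0290v3, §1.1 after (1.15): "the local existence theory is standard") is a Picard
iteration for the Duhamel map. We run it on the **lifted level** `g = ⟨D⟩¹⁰ u ∈ L²(ℝ³; ℂ³)`,
where the `H¹⁰` norm becomes the ambient `L²` norm and all time integrals are honest Bochner
integrals in the Hilbert space `L²`. This file supplies the three Fourier multipliers of that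
scheme, packaged as one existence statement (`exists_ops`, registered sub-goal
`stub_localExistence_Ops`) whose clauses are the only facts used downstream:

* `J = ⟨D⟩⁻¹⁰` (symbol `(1+|ξ|²)⁻⁵`), a bounded operator on `L²` with `‖J h‖_{H¹⁰} = ‖h‖_{L²}`,
  commuting with the heat propagator, and onto `H¹⁰`: every `f ∈ H¹⁰` is `J g` with
  `‖g‖ = ‖f‖_{H¹⁰}`;
* the lift `L = ⟨D⟩⁹ : H⁹ → L²`, `‖L F − L F'‖ = ‖F − F'‖_{H⁹}`;
* the **smoothing family** `P_σ = ⟨D⟩ e^{σΔ}`, `σ > 0` (symbol `(1+|ξ|²)^{1/2} e^{-4π²σ|ξ|²}`), with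
  the parabolic bound `‖P_σ‖ ≤ 1 + σ^{-1/2}`, the semigroup factorisation
  `P_σ = e^{(σ-ρ)Δ} P_ρ` (`0 < ρ ≤ σ`), and the intertwining `J P_σ L = e^{σΔ}` on `H⁹` — the
  lifted form of the one-derivative smoothing `‖e^{σΔ} F‖_{H¹⁰} ≤ (1 + σ^{-1/2}) ‖F‖_{H⁹}`.

## References

* T. Tao, J. Amer. Math. Soc. 29 (2016), 601–674, arXiv:1402.0290v3, §1.1 (1.15).

Not carried from this source module (not needed by the declarations re-homed here; their consumers are Summits-side): `enorm_weight_sq`, `enorm_eq_eFourierSobolevNorm_of_fourierFn`, `exists_lift`, `enorm_lift`, `enorm_lift_sub`, `memLp_top_jSymbol`, `eFourierSobolevNorm_ten_of_jSpec`, `j_heat_comm`, `j_eq_of_fourierFn`, `continuous_pSymbol`, `norm_pSymbol_le`, `memLp_top_pSymbol`, `exists_P`, `p_eq_heat_p`, `j_p_eq_heat`, `exists_ops`, `stub_localExistence_Ops`.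
-/

section Part2

open _root_.MeasureTheory _root_.Set _root_.Filter _root_.Topology FourierTransform
open scoped _root_.ENNReal _root_.NNReal

namespace Literature.Analysis.PerpetualPump.PerpetualPumpThesis.E

open Literature.Analysis.FluidPDE Literature.Analysis.FluidPDE.Tao2016
open Literature.Analysis.FunctionSpaces (eFourierSobolevNorm
  memLp_fourierWeight_smul_iff_eFourierSobolevNorm_lt_top)

/-! ### Weights and lifts -/

/-- `√y e^{-4π² y} ≤ 1` for `y ≥ 0` (`√y ≤ 1 + y ≤ e^y ≤ e^{4π² y}`).
[cite: Tao2016AveragedNS, §1.1 (1.15) p. 7 (local well-posedness of `H¹⁰_df` mild solutions: the bilinear Duhamel operator, uniqueness) (source of the NOTION / ARGUMENT this module implements; this declaration is the cell’s own lemma or plumbing, NOT a printed statement)] -/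
theorem sqrt_mul_exp_neg_le {y : ℝ} (hy : 0 ≤ y) :
    Real.sqrt y * Real.exp (-(4 * Real.pi ^ 2 * y)) ≤ 1 := by
  have h1 : Real.sqrt y ≤ 1 + y := by
    nlinarith [Real.sq_sqrt hy, Real.sqrt_nonneg y, sq_nonneg (Real.sqrt y - 1)]
  have h2 : 1 + y ≤ Real.exp (4 * Real.pi ^ 2 * y) := by
    have h3 : y ≤ 4 * Real.pi ^ 2 * y := by
      have : (1 : ℝ) ≤ 4 * Real.pi ^ 2 := by nlinarith [Real.two_le_pi]
      nlinarith
    calc 1 + y ≤ 4 * Real.pi ^ 2 * y + 1 := by linarith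
      _ ≤ Real.exp (4 * Real.pi ^ 2 * y) := Real.add_one_le_exp _
  calc Real.sqrt y * Real.exp (-(4 * Real.pi ^ 2 * y))
      ≤ Real.exp (4 * Real.pi ^ 2 * y) * Real.exp (-(4 * Real.pi ^ 2 * y)) :=
        mul_le_mul_of_nonneg_right (h1.trans h2) (Real.exp_pos _).le
    _ = 1 := by rw [← Real.exp_add, add_neg_cancel, Real.exp_zero]

/-- **The parabolic smoothing bound**: `(1+x)^{1/2} e^{-4π²σx} ≤ 1 + σ^{-1/2}` (`σ > 0`, `x ≥ 0`).
[cite: Tao2016AveragedNS, §1.1 (1.15) p. 7 (local well-posedness of `H¹⁰_df` mild solutions: the bilinear Duhamel operator, uniqueness) (source of the NOTION / ARGUMENT this module implements; this declaration is the cell’s own lemma or plumbing, NOT a printed statement)] -/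
theorem weight_half_mul_exp_le {σ : ℝ} (hσ : 0 < σ) {x : ℝ} (hx : 0 ≤ x) :
    (1 + x) ^ ((1 : ℝ) / 2) * Real.exp (-(4 * Real.pi ^ 2 * σ * x)) ≤ 1 + σ ^ (-(1 / 2 : ℝ)) := by
  set e := Real.exp (-(4 * Real.pi ^ 2 * σ * x)) with he
  have he0 : 0 < e := Real.exp_pos _
  have he1 : e ≤ 1 := by
    rw [he, Real.exp_le_one_iff, neg_nonpos]
    positivity
  have hsq : (1 + x) ^ ((1 : ℝ) / 2) = Real.sqrt (1 + x) := by
    rw [Real.sqrt_eq_rpow]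
  have h1 : Real.sqrt (1 + x) ≤ 1 + Real.sqrt x := by
    rw [Real.sqrt_le_left (by positivity)]
    nlinarith [Real.sq_sqrt hx, Real.sqrt_nonneg x]
  have h2 : Real.sqrt x * e ≤ σ ^ (-(1 / 2 : ℝ)) := by
    have hkey : Real.sqrt (σ * x) * e ≤ 1 := by
      rw [he, show 4 * Real.pi ^ 2 * σ * x = 4 * Real.pi ^ 2 * (σ * x) by ring]
      exact sqrt_mul_exp_neg_le (by positivity)
    have hsσ : 0 < Real.sqrt σ := Real.sqrt_pos.2 hσ
    calc Real.sqrt x * e = (Real.sqrt σ)⁻¹ * (Real.sqrt (σ * x) * e) := by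
          rw [Real.sqrt_mul hσ.le]; field_simp
      _ ≤ (Real.sqrt σ)⁻¹ * 1 := by gcongr
      _ = σ ^ (-(1 / 2 : ℝ)) := by rw [mul_one, Real.rpow_neg hσ.le, Real.sqrt_eq_rpow]
  calc (1 + x) ^ ((1 : ℝ) / 2) * e ≤ (1 + Real.sqrt x) * e := by
        rw [hsq]; exact mul_le_mul_of_nonneg_right h1 he0.le
    _ = e + Real.sqrt x * e := by ring
    _ ≤ 1 + σ ^ (-(1 / 2 : ℝ)) := add_le_add he1 h2

end E

open Literature.Analysis.FluidPDE Literature.Analysis.FluidPDE.Tao2016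
open Literature.Analysis.FunctionSpaces (eFourierSobolevNorm)

end Literature.Analysis.PerpetualPump.PerpetualPumpThesis

end Part2

/-!
## Part 3 — port of `Summits/NavierStokesRegularity/NavierStokesRegularity/Theorems/PerpetualPumpThesisLocalExistenceDuhamel.lean` (1 declarations kept)

# Stub E (`localExistence`) for `PerpetualPump.Thesis`, part II: the lifted Duhamel integral

Support file (part 2 of the stub `localExistence` of line `SketchIdeator2`, crux
stmt-NavierStokesRegularity-1832). For Tao's local `H¹⁰` theory (J. Amer. Math. Soc. 29 (2016),
arXiv:1402.0290v3, §1.1 after (1.15)) run on the lifted level `g = ⟨D⟩¹⁰u ∈ L²(ℝ³; ℂ³)`, the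
Duhamel term is the Bochner integral `D(t) = ∫₀ᵗ P_{t-s} G(s) ds = ∫₀ᵗ P_σ G(t-σ) dσ` in `L²`,
where `P_σ = ⟨D⟩e^{σΔ}` is any family of bounded operators with the **parabolic bound**
`‖P_σ‖ ≤ 1 + σ^{-1/2}` and the **semigroup factorisation** `P_σ = e^{(σ-ρ)Δ} P_ρ` (`0 < ρ ≤ σ`)
(part I), and `G` is a continuous bounded curve in `L²`. This file proves, abstractly in such a
family `P`:

* joint strong continuity of `(σ, h) ↦ P_σ h` on `σ > 0` (from the factorisation and the strong
  continuity of the heat propagator), hence measurability of the integrand, which has an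
  integrable singularity `σ^{-1/2}` at `σ = 0`: interval integrability
  (`intervalIntegrable_smoothing`) and the bound
  `‖∫ₐᵇ P_σ G(r-σ) dσ‖ ≤ N · |∫ₐᵇ (1 + σ^{-1/2}) dσ|` (`norm_integral_smoothing_le`);
* continuity of `t ↦ D(t)` on `[0, ∞)` (`continuousOn_duhamel`, registered sub-goal
  `stub_localExistence_Duhamel`), by splitting `D(t) − D(t₀)` into a short time integral and an
  integral of `P_σ (G(t-σ) − G(t₀-σ))`, small by uniform continuity of `G` on compacts;
* realness and closedness lemmas for `L²` limits and integrals of real fields.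

## References

* T. Tao, J. Amer. Math. Soc. 29 (2016), 601–674, arXiv:1402.0290v3, §1.1 (1.15).

Not carried from this source module (not needed by the declarations re-homed here; their consumers are Summits-side): `isClosed_setOf_isReal`, `isReal_intervalIntegral`, `heat_sub`, `continuous_heat₂`, `continuousAt_smoothing₂`, `continuousOn_smoothing_comp`, `intervalIntegrable_smoothing`, `norm_integral_smoothing_le`, `integral_smoothing_comp_sub`, `intervalIntegrable_smoothing_sub`, `continuousOn_duhamel`, `stub_localExistence_Duhamel`.
-/

section Part3

open _root_.MeasureTheory _root_.Set _root_.Filter _root_.Topology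
open scoped _root_.ENNReal _root_.NNReal Interval

namespace Literature.Analysis.PerpetualPump.PerpetualPumpThesis.E

open Literature.Analysis.FluidPDE Literature.Analysis.FluidPDE.Tao2016
open Literature.Analysis.PerpetualPump.PerpetualPumpEulerTypeIGlue
  (continuous_heat_apply norm_heat_le)

/-! ### Real fields: closedness and integrals -/

/-- The dominating function `σ ↦ 1 + σ^{-1/2}` is interval integrable on every interval.
[cite: Tao2016AveragedNS, §1.1 (1.15) p. 7 (local well-posedness of `H¹⁰_df` mild solutions: the bilinear Duhamel operator, uniqueness) (source of the NOTION / ARGUMENT this module implements; this declaration is the cell’s own lemma or plumbing, NOT a printed statement)] -/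
theorem intervalIntegrable_one_add_rpow (a b : ℝ) :
    IntervalIntegrable (fun σ : ℝ => 1 + σ ^ (-(1 / 2 : ℝ))) volume a b :=
  intervalIntegrable_const.add (intervalIntegral.intervalIntegrable_rpow' (by norm_num))

end E

open Literature.Analysis.FluidPDE Literature.Analysis.FluidPDE.Tao2016

end Literature.Analysis.PerpetualPump.PerpetualPumpThesis

end Part3

/-!
## Part 4 — port of `Summits/NavierStokesRegularity/NavierStokesRegularity/Theorems/PerpetualPumpThesisLocalExistenceStep.lean` (1 declarations kept)

# Stub E (`localExistence`) for `PerpetualPump.Thesis`, part III: one step of the lifted Picard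
# iteration

Support file (part 3 of the stub `localExistence` of line `SketchIdeator2`, crux
stmt-NavierStokesRegularity-1832). Tao's local `H¹⁰` theory for `∂ₜu = Δu + B̃(u,u)`
(J. Amer. Math. Soc. 29 (2016), arXiv:1402.0290v3, §1.1 after (1.15)) is run on the lifted
level `g = ⟨D⟩¹⁰u`: given a bilinear representative `Bop` of `B̃` with the tame bound
`‖Bop(u,v)‖_{H⁹} ≤ K‖u‖_{H¹⁰}‖v‖_{H¹⁰}` on `H¹⁰_df`, and the operator toolkit `(J, P, L)` of part I
(`J = ⟨D⟩⁻¹⁰`, `P_σ = ⟨D⟩e^{σΔ}`, `L = ⟨D⟩⁹`), the **lifted Duhamel map** is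
`Φ(g)(t) = e^{rΔ} g_a + ∫₀ʳ P_{r-s} L(Bop(Jg(s), Jg(s))) ds`, `r = max 0 (min t τ)` (clamped clock).
For curves `g` that are continuous, bounded by `M` and with `Jg(t) ∈ H¹⁰_df`, this file proves:

* the lifted forcing `G(s) = L(Bop(Jg(s), Jg(s)))` is continuous with `‖G‖ ≤ KM²` and
  `‖G − G'‖ ≤ 2KM‖g − g'‖` (bilinearity);
* `Φ(g)` is again such a curve: continuous (part II), bounded by `R + KM²η ≤ M` where
  `η` bounds `∫₀ʳ(1+σ^{-1/2})dσ` on `[0,τ]`, and `JΦ(g)(t) = e^{rΔ}a + ∫₀ʳ e^{(r-s)Δ}Bop(u,u) ds`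
  is real and divergence free (registered sub-goal `stub_localExistence_Step`);
* the contraction estimate `‖Φ(g)(t) − Φ(g')(t)‖ ≤ 2KMη · sup‖g − g'‖`.

## References

* T. Tao, J. Amer. Math. Soc. 29 (2016), 601–674, arXiv:1402.0290v3, §1.1 (1.15).

Not carried from this source module (not needed by the declarations re-homed here; their consumers are Summits-side): `memH10df_j`, `bop_lt_top`, `bop_sub_bop`, `ofReal_mul_enorm_enorm`, `norm_lift_bop_le`, `norm_lift_bop_sub_le`, `continuous_lift_bop`, `norm_phi_le`, `intervalIntegrable_phi`, `j_phi_eq`, `jp_isReal_isFourierDivFree`, `j_phi_isReal_isFourierDivFree`, `continuous_phi`, `norm_phi_sub_phi_le`, `stub_localExistence_Step`.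
-/

section Part4

open _root_.MeasureTheory _root_.Set _root_.Filter _root_.Topology
open scoped _root_.ENNReal _root_.NNReal Interval

namespace Literature.Analysis.PerpetualPump.PerpetualPumpThesis.E

open Literature.Analysis.FluidPDE Literature.Analysis.FluidPDE.Tao2016
open Literature.Analysis.FunctionSpaces (eFourierSobolevNorm)
open Literature.Analysis.PerpetualPump.PerpetualPumpEulerTypeIGlue
  (continuous_heat_apply norm_heat_le)

/-! ### The lifted forcing `G = L(Bop(Jg, Jg))` -/

/-- **Choice of the lifespan**: the primitive `∫₀ʳ (1 + σ^{-1/2}) dσ` is continuous and vanishes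
at `r = 0`, so it is `≤ η` on a short interval `[0, τ]`, `0 < τ ≤ 1`.
[cite: Tao2016AveragedNS, §1.1 (1.15) p. 7 (local well-posedness of `H¹⁰_df` mild solutions: the bilinear Duhamel operator, uniqueness) (source of the NOTION / ARGUMENT this module implements; this declaration is the cell’s own lemma or plumbing, NOT a printed statement)] -/
theorem exists_clock_bound {η : ℝ} (hη : 0 < η) : ∃ τ : ℝ, 0 < τ ∧ τ ≤ 1 ∧
    ∀ r ∈ Icc (0 : ℝ) τ, |∫ σ in (0 : ℝ)..r, (1 + σ ^ (-(1 / 2 : ℝ)))| ≤ η := by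
  have hβc : Continuous fun t => ∫ σ in (0 : ℝ)..t, (1 + σ ^ (-(1 / 2 : ℝ))) :=
    intervalIntegral.continuous_primitive intervalIntegrable_one_add_rpow 0
  obtain ⟨δ, hδ, hδ'⟩ := Metric.continuous_iff.1 hβc 0 η hη
  refine ⟨min (δ / 2) 1, by positivity, min_le_right _ _, fun r hr => ?_⟩
  have hrδ : dist r 0 < δ := by
    rw [Real.dist_eq, sub_zero, abs_of_nonneg hr.1]
    exact lt_of_le_of_lt (hr.2.trans (min_le_left _ _)) (half_lt_self hδ)
  have h := hδ' r hrδ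
  rw [Real.dist_eq, intervalIntegral.integral_same, sub_zero] at h
  exact h.le

/-! ### The lifted Duhamel map `Φ` -/

end E

open Literature.Analysis.FluidPDE Literature.Analysis.FluidPDE.Tao2016
open Literature.Analysis.FunctionSpaces (eFourierSobolevNorm)

end Literature.Analysis.PerpetualPump.PerpetualPumpThesis

end Part4

/-!
## Part 5 — port of `Summits/NavierStokesRegularity/NavierStokesRegularity/Theorems/PerpetualPumpThesisUniqueness.lean` (8 declarations kept)

# Stub U (`uniqueness`) for `PerpetualPump.Thesis`: uniqueness of `H¹⁰_df`-mild solutions of the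
# averaged Navier–Stokes equation

Final file of the stub `uniqueness` of line `SketchIdeator2` (crux stmt-NavierStokesRegularity-1832):
for an *arbitrary* averaging datum `𝒜` (T. Tao, J. Amer. Math. Soc. 29 (2016), arXiv:1402.0290v3,
§1.1 (1.12)–(1.13); no symmetry, no cancellation), any datum class `a ∈ L²(ℝ³; ℂ³)` and any `T`,
two mild `H¹⁰_df` solutions (1.15) of `∂ₜu = Δu + B̃(u,u)` on `[0, T)` with the same datum coincide
(`stub_uniqueness`; Tao, p. 7: the standard local theory after (1.15)).

Proof (the `L²` energy method): restrict to a compact `[0, b] ⊂ [0, T)`, where `u`, `v` are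
`H¹⁰`-bounded by some `M`. Testing the two Duhamel identities (1.15) at time `t` against the
admissible field `w = d(t) = u(t) - v(t) ∈ H¹⁰_df` and subtracting gives, by `⟨w, w⟩ = ‖w‖²` for
real `w` and the splitting `⟨B̃(u,u), h⟩ - ⟨B̃(v,v), h⟩ = ⟨B̃(d,u), h⟩ + ⟨B̃(v,d), h⟩` (part II),
`‖d(t)‖² = ∫₀ᵗ ⟨B̃(d,u) + B̃(v,d), e^{(t-s)Δ} d(t)⟩ ds` (the integrands are continuous, part II, so
the interval integrals are honest). By the `L² × H¹⁰ × H¹` bound of part I and the parabolic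
smoothing `‖e^{σΔ} w‖_{H¹} ≤ (1 + σ^{-1/2}) ‖w‖_{L²}` (`eFourierSobolevNorm_one_heat_le`) the
integrand is at most `2KM (1 + (t-s)^{-1/2}) ‖d(s)‖ ‖d(t)‖`, whence the Volterra inequality
`‖d(t)‖ ≤ 2KM ∫_{t₀}^t (1 + (t-s)^{-1/2}) ‖d(s)‖ ds` whenever `d = 0` on `[0, t₀]`
(`norm_sub_le_step`). Since `∫₀^δ (1 + σ^{-1/2}) dσ → 0` as `δ → 0`, on each window
`[kδ, (k+1)δ]` the supremum of `‖d‖` is at most half of itself, hence zero; induction on `k`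
(`eq_on_Icc`).

## References

* T. Tao, J. Amer. Math. Soc. 29 (2016), 601–674, arXiv:1402.0290v3, §1.1 (1.9), (1.12)–(1.15).
-/

section Part5

open _root_.MeasureTheory _root_.Set _root_.Filter _root_.Topology
open scoped _root_.ENNReal _root_.NNReal

namespace Literature.Analysis.PerpetualPump.PerpetualPumpThesis.U

open Literature.Analysis.FluidPDE Literature.Analysis.FluidPDE.Tao2016
open Literature.Analysis.FunctionSpaces (eFourierSobolevNorm)

/-! ### Parabolic smoothing: `e^{σΔ}` maps `L²` into `H¹` with norm `≤ 1 + σ^{-1/2}` -/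

/-- The pointwise symbol bound `(1+|ξ|²) |e^{-4π²σ|ξ|²}|² ≤ (1 + σ^{-1/2})²` for `σ > 0`.
[cite: Tao2016AveragedNS, §1.1 (1.15) p. 7 (local well-posedness of `H¹⁰_df` mild solutions: the bilinear Duhamel operator, uniqueness) (source of the NOTION / ARGUMENT this module implements; this declaration is the cell’s own lemma or plumbing, NOT a printed statement)] -/
theorem sobolevWeight_one_mul_norm_heatSymbol_sq_le {σ : ℝ} (hσ : 0 < σ) (ξ : EuclideanSpace ℝ (Fin 3)) :
    (1 + ‖ξ‖ ^ 2) ^ (1 : ℝ) * ‖heatSymbol σ ξ‖ ^ 2 ≤ (1 + σ ^ (-(1 / 2 : ℝ))) ^ 2 := by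
  have h := E.weight_half_mul_exp_le hσ (sq_nonneg ‖ξ‖)
  have hn : ‖heatSymbol σ ξ‖ = Real.exp (-(4 * Real.pi ^ 2 * σ * ‖ξ‖ ^ 2)) := by
    rw [heatSymbol, max_eq_left hσ.le, Complex.norm_real, Real.norm_of_nonneg (Real.exp_pos _).le]
  have h0 : 0 ≤ (1 + ‖ξ‖ ^ 2) ^ ((1 : ℝ) / 2) * Real.exp (-(4 * Real.pi ^ 2 * σ * ‖ξ‖ ^ 2)) := by
    positivity
  have hsq : ((1 + ‖ξ‖ ^ 2) ^ ((1 : ℝ) / 2)) ^ 2 = (1 + ‖ξ‖ ^ 2) ^ (1 : ℝ) := by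
    rw [Real.rpow_one, ← Real.sqrt_eq_rpow, Real.sq_sqrt (by positivity)]
  calc (1 + ‖ξ‖ ^ 2) ^ (1 : ℝ) * ‖heatSymbol σ ξ‖ ^ 2
      = ((1 + ‖ξ‖ ^ 2) ^ ((1 : ℝ) / 2) * Real.exp (-(4 * Real.pi ^ 2 * σ * ‖ξ‖ ^ 2))) ^ 2 := by
        rw [hn, mul_pow, hsq]
    _ ≤ (1 + σ ^ (-(1 / 2 : ℝ))) ^ 2 := pow_le_pow_left₀ h0 h 2

/-- **Parabolic smoothing of the heat propagator**: `‖e^{σΔ} w‖_{H¹} ≤ (1 + σ^{-1/2}) ‖w‖_{L²}` for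
`σ > 0` (the symbol bound `⟨ξ⟩ e^{-4π²σ|ξ|²} ≤ 1 + σ^{-1/2}` and Plancherel).
[cite: Tao2016AveragedNS, §1.1 (1.15) p. 7 (local well-posedness of `H¹⁰_df` mild solutions: the bilinear Duhamel operator, uniqueness) (source of the NOTION / ARGUMENT this module implements; this declaration is the cell’s own lemma or plumbing, NOT a printed statement)] -/
theorem eFourierSobolevNorm_one_heat_le {σ : ℝ} (hσ : 0 < σ) (w : L2C) :
    eFourierSobolevNorm 1 (heat σ w) ≤ ENNReal.ofReal (1 + σ ^ (-(1 / 2 : ℝ))) * ‖w‖ₑ := by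
  rw [eFourierSobolevNorm_eq]
  unfold sobolevWeightIntegral
  have hpt : ∀ᵐ ξ ∂(volume : Measure (EuclideanSpace ℝ (Fin 3))),
      ENNReal.ofReal ((1 + ‖ξ‖ ^ 2) ^ (1 : ℝ)) * ‖fourierFn (heat σ w) ξ‖ₑ ^ 2 ≤
        ENNReal.ofReal ((1 + σ ^ (-(1 / 2 : ℝ))) ^ 2) * ‖fourierFn w ξ‖ₑ ^ 2 := by
    filter_upwards [fourierFn_heat σ w] with ξ hξ
    rw [hξ, enorm_smul, mul_pow, ← mul_assoc]
    refine mul_le_mul' ?_ le_rfl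
    rw [← ofReal_norm, ← ENNReal.ofReal_pow (norm_nonneg _), ← ENNReal.ofReal_mul (by positivity)]
    exact ENNReal.ofReal_le_ofReal (sobolevWeight_one_mul_norm_heatSymbol_sq_le hσ ξ)
  calc (∫⁻ ξ, ENNReal.ofReal ((1 + ‖ξ‖ ^ 2) ^ (1 : ℝ)) * ‖fourierFn (heat σ w) ξ‖ₑ ^ 2) ^ (1 / 2 : ℝ)
      ≤ (∫⁻ ξ, ENNReal.ofReal ((1 + σ ^ (-(1 / 2 : ℝ))) ^ 2) * ‖fourierFn w ξ‖ₑ ^ 2) ^ (1 / 2 : ℝ) :=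
        ENNReal.rpow_le_rpow (lintegral_mono_ae hpt) (by norm_num)
    _ = ENNReal.ofReal (1 + σ ^ (-(1 / 2 : ℝ))) * ‖w‖ₑ := by
        rw [lintegral_const_mul' _ _ ENNReal.ofReal_ne_top, ENNReal.mul_rpow_of_nonneg _ _ (by norm_num),
          lintegral_enorm_sq_fourierFn_rpow_eq, ENNReal.ofReal_pow (by positivity),
          ← ENNReal.rpow_natCast, ← ENNReal.rpow_mul]
        norm_num

/-! ### The energy inequality for the difference of two mild solutions -/

/-- `‖x‖_{L²} ≤ M` when `‖x‖_{H¹⁰} ≤ M`.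
[cite: Tao2016AveragedNS, §1.1 (1.15) p. 7 (local well-posedness of `H¹⁰_df` mild solutions: the bilinear Duhamel operator, uniqueness) (source of the NOTION / ARGUMENT this module implements; this declaration is the cell’s own lemma or plumbing, NOT a printed statement)] -/
theorem norm_le_of_H10_le {x : L2C} {M : ℝ} (hM0 : 0 ≤ M)
    (hx : eFourierSobolevNorm 10 x ≤ ENNReal.ofReal M) : ‖x‖ ≤ M := by
  have h := (enorm_le_eFourierSobolevNorm (by norm_num : (0 : ℝ) ≤ 10) x).trans hx
  rwa [← ofReal_norm, ENNReal.ofReal_le_ofReal_iff hM0] at h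

/-- **The `L²` bound for the difference of the two quadratic terms**: with the `L² × H¹⁰ × H¹`
constant `K` of part I, `‖x‖_{H¹⁰}, ‖y‖_{H¹⁰} ≤ M` and `‖h‖_{H¹} ≤ N`,
`|⟨B̃(x,x), h⟩ - ⟨B̃(y,y), h⟩| ≤ 2 K M N ‖x - y‖_{L²}`.
[cite: Tao2016AveragedNS, §1.1 (1.15) p. 7 (local well-posedness of `H¹⁰_df` mild solutions: the bilinear Duhamel operator, uniqueness) (source of the NOTION / ARGUMENT this module implements; this declaration is the cell’s own lemma or plumbing, NOT a printed statement)] -/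
theorem norm_form_sub_form_le (𝒜 : AveragingDatum) {K1 : ℝ≥0}
    (hK1 : ∀ f g h : L2C, eFourierSobolevNorm 10 g < ⊤ → eFourierSobolevNorm 1 h < ⊤ →
      ‖𝒜.form f g h‖ₑ ≤ (K1 : ℝ≥0∞) * ‖f‖ₑ * eFourierSobolevNorm 10 g * eFourierSobolevNorm 1 h ∧
      ‖𝒜.form g f h‖ₑ ≤ (K1 : ℝ≥0∞) * ‖f‖ₑ * eFourierSobolevNorm 10 g * eFourierSobolevNorm 1 h)
    {x y h : L2C} {M N : ℝ} (hM0 : 0 ≤ M) (hN0 : 0 ≤ N)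
    (hx : eFourierSobolevNorm 10 x ≤ ENNReal.ofReal M) (hy : eFourierSobolevNorm 10 y ≤ ENNReal.ofReal M)
    (hh : eFourierSobolevNorm 1 h ≤ ENNReal.ofReal N) :
    ‖𝒜.form x x h - 𝒜.form y y h‖ ≤ 2 * K1 * M * N * ‖x - y‖ := by
  have hxt : eFourierSobolevNorm 10 x < ⊤ := hx.trans_lt ENNReal.ofReal_lt_top
  have hyt : eFourierSobolevNorm 10 y < ⊤ := hy.trans_lt ENNReal.ofReal_lt_top
  have hht : eFourierSobolevNorm 1 h < ⊤ := hh.trans_lt ENNReal.ofReal_lt_top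
  have key : ∀ z : ℂ, ‖z‖ₑ ≤ (K1 : ℝ≥0∞) * ‖x - y‖ₑ * ENNReal.ofReal M * ENNReal.ofReal N →
      ‖z‖ ≤ K1 * M * N * ‖x - y‖ := by
    intro z hz
    have hfin : (K1 : ℝ≥0∞) * ‖x - y‖ₑ * ENNReal.ofReal M * ENNReal.ofReal N ≠ ⊤ :=
      ENNReal.mul_ne_top (ENNReal.mul_ne_top (ENNReal.mul_ne_top ENNReal.coe_ne_top enorm_ne_top)
        ENNReal.ofReal_ne_top) ENNReal.ofReal_ne_top
    have h' := ENNReal.toReal_mono hfin hz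
    rw [toReal_enorm, ENNReal.toReal_mul, ENNReal.toReal_mul, ENNReal.toReal_mul, ENNReal.coe_toReal,
      toReal_enorm, ENNReal.toReal_ofReal hM0, ENNReal.toReal_ofReal hN0] at h'
    exact h'.trans_eq (by ring)
  have h1 : ‖𝒜.form (x - y) x h‖ ≤ K1 * M * N * ‖x - y‖ := key _
    (((hK1 (x - y) x h hxt hht).1).trans (mul_le_mul' (mul_le_mul' le_rfl hx) hh))
  have h2 : ‖𝒜.form y (x - y) h‖ ≤ K1 * M * N * ‖x - y‖ := key _
    (((hK1 (x - y) y h hyt hht).2).trans (mul_le_mul' (mul_le_mul' le_rfl hy) hh))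
  rw [form_sub_form 𝒜 h hxt hyt]
  calc ‖𝒜.form (x - y) x h + 𝒜.form y (x - y) h‖
      ≤ ‖𝒜.form (x - y) x h‖ + ‖𝒜.form y (x - y) h‖ := norm_add_le _ _
    _ ≤ K1 * M * N * ‖x - y‖ + K1 * M * N * ‖x - y‖ := add_le_add h1 h2
    _ = 2 * K1 * M * N * ‖x - y‖ := by ring

/-- **Two mild solutions with the same datum agree at time `0`** (the datum is attained in
`(H¹⁰_df)*`, and `u(0) - v(0)` is itself an admissible test field).
[cite: Tao2016AveragedNS, §1.1 (1.15) p. 7 (local well-posedness of `H¹⁰_df` mild solutions: the bilinear Duhamel operator, uniqueness) (source of the NOTION / ARGUMENT this module implements; this declaration is the cell’s own lemma or plumbing, NOT a printed statement)] -/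
theorem eq_of_initial {T : L2C → L2C → L2C → ℂ} {a : L2C} {I : Set ℝ} {u v : ℝ → L2C}
    (hu : IsMildSolutionFor T a I u) (hv : IsMildSolutionFor T a I v) (h0 : (0 : ℝ) ∈ I) :
    u 0 = v 0 := by
  have hw : MemH10df (u 0 - v 0) := (hu.1 0 h0).sub (hv.1 0 h0)
  have h3 : pairing (u 0 - v 0) (u 0 - v 0) = 0 := by
    rw [pairing_sub_left, hu.initial h0 hw, hv.initial h0 hw, sub_self]
  rw [pairing_self hw.2.1] at h3
  have h4 : ‖u 0 - v 0‖ ^ 2 = 0 := by exact_mod_cast h3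
  exact sub_eq_zero.1 (norm_eq_zero.1 (pow_eq_zero_iff two_ne_zero |>.1 h4))

/-- **The Volterra inequality for the difference of two mild solutions** on `[0, b]`: if `u`, `v`
are mild solutions with the same datum, `H¹⁰`-bounded by `M`, and `d = u - v` vanishes on
`[0, t₀]` and is bounded by `Bd` in `L²` on `[t₀, t]`, then
`‖d(t)‖ ≤ 2 K M · Bd · ∫₀^{t-t₀} (1 + σ^{-1/2}) dσ`
(energy identity tested against `w = d(t)`, the `L² × H¹⁰ × H¹` bound, parabolic smoothing).
[cite: Tao2016AveragedNS, §1.1 (1.15) p. 7 (local well-posedness of `H¹⁰_df` mild solutions: the bilinear Duhamel operator, uniqueness) (source of the NOTION / ARGUMENT this module implements; this declaration is the cell’s own lemma or plumbing, NOT a printed statement)] -/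
theorem norm_sub_le_step (𝒜 : AveragingDatum) {K1 : ℝ≥0}
    (hK1 : ∀ f g h : L2C, eFourierSobolevNorm 10 g < ⊤ → eFourierSobolevNorm 1 h < ⊤ →
      ‖𝒜.form f g h‖ₑ ≤ (K1 : ℝ≥0∞) * ‖f‖ₑ * eFourierSobolevNorm 10 g * eFourierSobolevNorm 1 h ∧
      ‖𝒜.form g f h‖ₑ ≤ (K1 : ℝ≥0∞) * ‖f‖ₑ * eFourierSobolevNorm 10 g * eFourierSobolevNorm 1 h)
    {a : L2C} {b : ℝ} {u v : ℝ → L2C} (hu : IsMildSolutionFor 𝒜.form a (Icc 0 b) u)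
    (hv : IsMildSolutionFor 𝒜.form a (Icc 0 b) v) {M : ℝ} (hM0 : 0 ≤ M)
    (hMu : ∀ s ∈ Icc 0 b, eFourierSobolevNorm 10 (u s) ≤ ENNReal.ofReal M)
    (hMv : ∀ s ∈ Icc 0 b, eFourierSobolevNorm 10 (v s) ≤ ENNReal.ofReal M)
    {t₀ t : ℝ} (ht₀ : 0 ≤ t₀) (ht₀t : t₀ ≤ t) (htb : t ≤ b) {Bd : ℝ} (hBd : 0 ≤ Bd)
    (h0 : ∀ s ∈ Icc 0 t₀, u s = v s) (hB : ∀ s ∈ Icc t₀ t, ‖u s - v s‖ ≤ Bd) :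
    ‖u t - v t‖ ≤ 2 * K1 * M * Bd * |∫ σ in (0 : ℝ)..(t - t₀), (1 + σ ^ (-(1 / 2 : ℝ)))| := by
  have ht : t ∈ Icc 0 b := ⟨ht₀.trans ht₀t, htb⟩
  have h0b : (0 : ℝ) ∈ Icc 0 b := ⟨le_rfl, ht.1.trans ht.2⟩
  have ht₀b : t₀ ∈ Icc 0 b := ⟨ht₀, ht₀t.trans htb⟩
  set w : L2C := u t - v t with hw_def
  have hw : MemH10df w := (hu.1 t ht).sub (hv.1 t ht)
  -- the two Duhamel integrands
  set Fu : ℝ → ℂ := fun s => 𝒜.form (u s) (u s) (heat (t - s) w) with hFu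
  set Fv : ℝ → ℂ := fun s => 𝒜.form (v s) (v s) (heat (t - s) w) with hFv
  have hcu : ContinuousOn Fu (Icc 0 b) := continuousOn_form_heat 𝒜 hu.2.1 hMu w t
  have hcv : ContinuousOn Fv (Icc 0 b) := continuousOn_form_heat 𝒜 hv.2.1 hMv w t
  have hcG : ContinuousOn (fun s => Fu s - Fv s) (Icc 0 b) := hcu.sub hcv
  have hint : ∀ {t₁ t₂ : ℝ}, t₁ ∈ Icc 0 b → t₂ ∈ Icc 0 b → ∀ {F : ℝ → ℂ}, ContinuousOn F (Icc 0 b) →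
      IntervalIntegrable F volume t₁ t₂ :=
    fun h₁ h₂ _ hF => (hF.mono (uIcc_subset_Icc h₁ h₂)).intervalIntegrable
  -- the integrand vanishes on `[0, t₀]`
  have hvanish : ∫ s in (0 : ℝ)..t₀, (Fu s - Fv s) = 0 := by
    rw [intervalIntegral.integral_congr (g := fun _ => (0 : ℂ)) ?_, intervalIntegral.integral_zero]
    intro s hs
    rw [uIcc_of_le ht₀] at hs
    show Fu s - Fv s = 0
    simp only [hFu, hFv, h0 s hs, sub_self]
  -- the energy identity `‖w‖² = ∫_{t₀}^t (Fu - Fv)`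
  have eu : pairing (u t) w = pairing (heat t a) w + ∫ s in (0 : ℝ)..t, Fu s := hu.2.2 t ht w hw
  have ev : pairing (v t) w = pairing (heat t a) w + ∫ s in (0 : ℝ)..t, Fv s := hv.2.2 t ht w hw
  have hId : ((‖w‖ ^ 2 : ℝ) : ℂ) = ∫ s in t₀..t, (Fu s - Fv s) := by
    calc ((‖w‖ ^ 2 : ℝ) : ℂ) = pairing w w := (pairing_self hw.2.1).symm
      _ = pairing (u t) w - pairing (v t) w := by rw [hw_def, pairing_sub_left]
      _ = (∫ s in (0 : ℝ)..t, Fu s) - ∫ s in (0 : ℝ)..t, Fv s := by rw [eu, ev]; ring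
      _ = ∫ s in (0 : ℝ)..t, (Fu s - Fv s) :=
          (intervalIntegral.integral_sub (hint h0b ht hcu) (hint h0b ht hcv)).symm
      _ = (∫ s in (0 : ℝ)..t₀, (Fu s - Fv s)) + ∫ s in t₀..t, (Fu s - Fv s) :=
          (intervalIntegral.integral_add_adjacent_intervals (hint h0b ht₀b hcG) (hint ht₀b ht hcG)).symm
      _ = ∫ s in t₀..t, (Fu s - Fv s) := by rw [hvanish, zero_add]
  -- pointwise bound on the integrand off the endpoint `s = t`
  set c : ℝ := 2 * K1 * M * ‖w‖ * Bd with hc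
  have hc0 : 0 ≤ c := by positivity
  have hpt : ∀ᵐ s ∂(volume : Measure ℝ), s ∈ Ioc t₀ t →
      ‖Fu s - Fv s‖ ≤ c * (1 + (t - s) ^ (-(1 / 2 : ℝ))) := by
    filter_upwards [Measure.ae_ne volume t] with s hst hs
    have hslt : s < t := lt_of_le_of_ne hs.2 hst
    have hσ : 0 < t - s := sub_pos.2 hslt
    have hs0b : s ∈ Icc 0 b := ⟨ht₀.trans hs.1.le, hs.2.trans htb⟩
    have hN : eFourierSobolevNorm 1 (heat (t - s) w) ≤
        ENNReal.ofReal ((1 + (t - s) ^ (-(1 / 2 : ℝ))) * ‖w‖) := by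
      rw [ENNReal.ofReal_mul (by positivity), ofReal_norm]
      exact eFourierSobolevNorm_one_heat_le hσ w
    have hG := norm_form_sub_form_le 𝒜 hK1 hM0 (by positivity) (hMu s hs0b) (hMv s hs0b) hN
    calc ‖Fu s - Fv s‖ ≤ 2 * K1 * M * ((1 + (t - s) ^ (-(1 / 2 : ℝ))) * ‖w‖) * ‖u s - v s‖ := hG
      _ ≤ 2 * K1 * M * ((1 + (t - s) ^ (-(1 / 2 : ℝ))) * ‖w‖) * Bd :=
          mul_le_mul_of_nonneg_left (hB s ⟨hs.1.le, hs.2⟩) (by positivity)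
      _ = c * (1 + (t - s) ^ (-(1 / 2 : ℝ))) := by rw [hc]; ring
  -- integrate
  have hgi : IntervalIntegrable (fun s => c * (1 + (t - s) ^ (-(1 / 2 : ℝ)))) volume t₀ t := by
    have h := (E.intervalIntegrable_one_add_rpow (t - t₀) 0).comp_sub_left t
    rw [sub_sub_cancel, sub_zero] at h
    exact h.const_mul c
  have hnorm : ‖w‖ ^ 2 ≤ c * |∫ σ in (0 : ℝ)..(t - t₀), (1 + σ ^ (-(1 / 2 : ℝ)))| := by
    have h1 := intervalIntegral.norm_integral_le_of_norm_le ht₀t hpt hgi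
    rw [← hId, Complex.norm_real, Real.norm_of_nonneg (sq_nonneg _),
      intervalIntegral.integral_const_mul] at h1
    refine h1.trans (mul_le_mul_of_nonneg_left ?_ hc0)
    have h2 := intervalIntegral.integral_comp_sub_left (fun σ => 1 + σ ^ (-(1 / 2 : ℝ))) t
      (a := t₀) (b := t)
    simp only [sub_self] at h2
    rw [h2]
    exact le_abs_self _
  -- divide by `‖w‖`
  by_cases hw0 : ‖w‖ = 0
  · rw [hw0]; positivity
  · have hwpos : 0 < ‖w‖ := (norm_nonneg _).lt_of_ne (Ne.symm hw0)
    have h2 : ‖w‖ * ‖w‖ ≤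
        ‖w‖ * (2 * K1 * M * Bd * |∫ σ in (0 : ℝ)..(t - t₀), (1 + σ ^ (-(1 / 2 : ℝ)))|) := by
      rw [← sq, hc] at *
      convert hnorm using 1
      ring
    exact le_of_mul_le_mul_left h2 hwpos

/-! ### Uniqueness on compact intervals by stepping -/

/-- **Uniqueness of mild `H¹⁰_df` solutions on a compact interval `[0, b]`** for an arbitrary
averaging datum: the Volterra inequality with a kernel of vanishing short-time mass forces
`d = u - v` to vanish on successive windows `[kδ, (k+1)δ]`.
[cite: Tao2016AveragedNS, §1.1 (1.15) p. 7 (local well-posedness of `H¹⁰_df` mild solutions: the bilinear Duhamel operator, uniqueness) (source of the NOTION / ARGUMENT this module implements; this declaration is the cell’s own lemma or plumbing, NOT a printed statement)] -/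
theorem eq_on_Icc (𝒜 : AveragingDatum) {a : L2C} {b : ℝ} {u v : ℝ → L2C}
    (hu : IsMildSolutionFor 𝒜.form a (Icc 0 b) u) (hv : IsMildSolutionFor 𝒜.form a (Icc 0 b) v) :
    ∀ t ∈ Icc 0 b, u t = v t := by
  obtain ⟨K1, hK1⟩ := exists_enorm_form_le_one 𝒜
  obtain ⟨Mu, hMu⟩ := ContinuousInH10On.exists_bound hu.2.1 fun s hs => (hu.1 s hs).1
  obtain ⟨Mv, hMv⟩ := ContinuousInH10On.exists_bound hv.2.1 fun s hs => (hv.1 s hs).1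
  set M : ℝ := max (max Mu Mv) 0 with hM
  have hM0 : 0 ≤ M := le_max_right _ _
  have hMu' : ∀ s ∈ Icc 0 b, eFourierSobolevNorm 10 (u s) ≤ ENNReal.ofReal M := fun s hs => by
    rw [← ENNReal.ofReal_toReal (hu.1 s hs).1.ne]
    exact ENNReal.ofReal_le_ofReal ((hMu s hs).trans ((le_max_left _ _).trans (le_max_left _ _)))
  have hMv' : ∀ s ∈ Icc 0 b, eFourierSobolevNorm 10 (v s) ≤ ENNReal.ofReal M := fun s hs => by
    rw [← ENNReal.ofReal_toReal (hv.1 s hs).1.ne]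
    exact ENNReal.ofReal_le_ofReal ((hMv s hs).trans ((le_max_right _ _).trans (le_max_left _ _)))
  -- the crude `L²` bound on the difference
  have hcrude : ∀ s ∈ Icc 0 b, ‖u s - v s‖ ≤ 2 * M := fun s hs =>
    (norm_sub_le _ _).trans (by
      linarith [norm_le_of_H10_le hM0 (hMu' s hs), norm_le_of_H10_le hM0 (hMv' s hs)])
  -- the step length
  set C : ℝ := 2 * K1 * M with hC
  have hC0 : 0 ≤ C := by positivity
  obtain ⟨δ, hδ, -, hδη⟩ := E.exists_clock_bound (η := 1 / (2 * (C + 1))) (by positivity)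
  have hstep : C * (1 / (2 * (C + 1))) ≤ 1 / 2 := by
    rw [mul_one_div, div_le_iff₀ (by positivity)]
    linarith
  -- induction on the windows `[kδ, (k+1)δ]`
  have key : ∀ k : ℕ, ∀ s ∈ Icc 0 b, s ≤ k * δ → u s = v s := by
    intro k
    induction k with
    | zero =>
      intro s hs hsk
      rw [Nat.cast_zero, zero_mul] at hsk
      have hs0 : s = 0 := le_antisymm hsk hs.1
      rw [hs0]
      exact eq_of_initial hu hv ⟨le_rfl, hs.1.trans hs.2⟩
    | succ k ih =>
      have hkδ : 0 ≤ (k : ℝ) * δ := by positivity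
      -- halving the bound on the new window, `n` times
      have inner : ∀ n : ℕ, ∀ t ∈ Icc 0 b, t ≤ ((k + 1 : ℕ) : ℝ) * δ → ‖u t - v t‖ ≤ 2 * M / 2 ^ n := by
        intro n
        induction n with
        | zero =>
          intro t ht _
          rw [pow_zero, div_one]
          exact hcrude t ht
        | succ n ihn =>
          intro t ht htk
          by_cases htk' : t ≤ k * δ
          · rw [ih t ht htk', sub_self, norm_zero]
            positivity
          · have htk'' : (k : ℝ) * δ < t := not_le.1 htk'
            have hBd : 0 ≤ 2 * M / 2 ^ n := by positivity
            have h := norm_sub_le_step 𝒜 hK1 hu hv hM0 hMu' hMv' hkδ htk''.le ht.2 hBd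
              (fun s hs => ih s ⟨hs.1, hs.2.trans (htk''.le.trans ht.2)⟩ hs.2)
              (fun s hs => ihn s ⟨hkδ.trans hs.1, hs.2.trans ht.2⟩ (hs.2.trans htk))
            have hr : t - k * δ ∈ Icc 0 δ := by
              refine ⟨sub_nonneg.2 htk''.le, ?_⟩
              push_cast at htk
              linarith
            have hI := hδη (t - k * δ) hr
            calc ‖u t - v t‖
                ≤ 2 * K1 * M * (2 * M / 2 ^ n) * |∫ σ in (0 : ℝ)..(t - k * δ), (1 + σ ^ (-(1 / 2 : ℝ)))| := h
              _ ≤ 2 * K1 * M * (2 * M / 2 ^ n) * (1 / (2 * (C + 1))) := by gcongr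
              _ = (2 * M / 2 ^ n) * (C * (1 / (2 * (C + 1)))) := by rw [hC]; ring
              _ ≤ (2 * M / 2 ^ n) * (1 / 2) := mul_le_mul_of_nonneg_left hstep hBd
              _ = 2 * M / 2 ^ (n + 1) := by rw [pow_succ]; ring
      intro s hs hsk
      have hlim : Tendsto (fun n : ℕ => 2 * M / 2 ^ n) atTop (𝓝 0) :=
        tendsto_const_nhds.div_atTop (tendsto_pow_atTop_atTop_of_one_lt one_lt_two)
      have hle : ‖u s - v s‖ ≤ 0 := ge_of_tendsto' hlim fun n => inner n s hs hsk
      exact sub_eq_zero.1 (norm_le_zero_iff.1 hle)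
  intro t ht
  obtain ⟨k, hk⟩ := exists_nat_ge (t / δ)
  exact key k t ht ((div_le_iff₀ hδ).1 hk)

end Literature.Analysis.PerpetualPump.PerpetualPumpThesis.U

namespace Literature.Analysis.PerpetualPump.PerpetualPumpThesis

open Literature.Analysis.FluidPDE Literature.Analysis.FluidPDE.Tao2016
open Literature.Analysis.FunctionSpaces

/-- **Stub U (`uniqueness`) of line `SketchIdeator2`: uniqueness of `H¹⁰_df`-mild solutions of the
averaged Navier–Stokes equation.** For every averaging datum `𝒜` (Tao 2016, (1.12)–(1.13); no
symmetry or cancellation needed), every datum class `a ∈ L²(ℝ³; ℂ³)` and every `T`, two mild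
solutions (1.15) of `∂ₜu = Δu + B̃(u,u)` with datum `a` on `[0, T)` agree on `[0, T)` (vacuous for
`T ≤ 0`). Proof: `L²`-energy inequality for the difference tested against itself, parabolic
smoothing, and a Volterra/Grönwall stepping argument on compact sub-intervals (`U.eq_on_Icc`).
[cite: Tao2016AveragedNS, §1.1 (1.15) p. 7 (local well-posedness of `H¹⁰_df` mild solutions: the bilinear Duhamel operator, uniqueness) (source of the NOTION / ARGUMENT this module implements; this declaration is the cell’s own lemma or plumbing, NOT a printed statement)] -/
theorem stub_uniqueness :
    ∀ 𝒜 : AveragingDatum, ∀ (a : L2C) (T : ℝ) (u v : ℝ → L2C),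
      IsMildSolutionFor 𝒜.form a (Ico 0 T) u → IsMildSolutionFor 𝒜.form a (Ico 0 T) v →
      ∀ t ∈ Ico 0 T, u t = v t := by
  intro 𝒜 a T u v hu hv t ht
  have hsub : Icc 0 t ⊆ Ico 0 T := fun s hs => ⟨hs.1, lt_of_le_of_lt hs.2 ht.2⟩
  exact U.eq_on_Icc 𝒜 (hu.mono hsub) (hv.mono hsub) t ⟨ht.1, le_rfl⟩

end Literature.Analysis.PerpetualPump.PerpetualPumpThesis

end Part5

/-!
## Part 6 — port of `Summits/NavierStokesRegularity/NavierStokesRegularity/Theorems/PumpContinuationMildBlowupClassical.lean` (5 declarations kept)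

# Route PumpContinuation · support `MildBlowupClassical` (stmt-NavierStokesRegularity-18304) — PROOF

`MildBlowupClassical`: an `H¹⁰_df`-mild solution (Tao 2016, (1.5)/(1.15), `ν = 1`) of the true
Navier–Stokes form from a Schwartz divergence-free datum `u₀` on `[0, S)` admitting no mild extension
past `S` yields X5a — a maximal smooth solution with finite lifespan, Leray–Hopf from its rapidly
decaying datum.

Proof (all ingredients are theorems of the tree):

1. `u₀` has **no global Kato (`C_t L³`-mild) solution**: a global Kato solution from a Schwartz datum
   carries Tao-class classical solutions on every closed slab (`C([0,T]; L³)` is a regularity class,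
   `exists_isTaoSolutionOn_of_hasGlobalKatoSolution'`); on `[0, S + 1)` such a solution is Leray–Hopf,
   hence (the PROVED front end of `EulerTypeIGlue`: `stub_memH10`, `stub_continuity`,
   `stub_identityTests`, `stub_cubic`, `stub_testToH10`) an `H¹⁰_df`-mild solution of Tao's identity
   with datum `schwartzL2 u₀`, which by uniqueness of `H¹⁰_df`-mild solutions (`stub_uniqueness` at
   the Euler datum, `AveragedTypeI.euler_form_eq`) agrees with `u` on `[0, S)` — a mild extension past `S`, excluded.
2. Hence (Lemarié-Rieusset Thm. 15.1 / Rusin–Šverák §4, `exists_singularPoint_katoMaximalTime` with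
   the discharged `kato_local_holds`, `continuation_of_bounded_holds`, `farField_bound_holds`) the Kato
   maximal time `T = T_max(u₀)` is finite and positive and the maximal Kato solution `u_K` has a
   singular point `(T, x_*)`: `‖u_K‖_{L^∞(Q_r(T, x_*))} = ∞` for every `r > 0`.
3. Tao-class solutions from `u₀` exist on every `[0, Tₙ]`, `Tₙ ↑ T`
   (`exists_isTaoSolutionOn_of_isKatoSolutionOn`), agree on overlaps (Prodi–Serrin) and glue to a
   classical solution `(w, p)` on `[0, T)` (`IsClassicalNSSolutionOn.exists_glue_Ico_right`), equal
   a.e. slice-wise to `u_K` (`kato_unique`).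
4. Leray–Hopf on `[0, T]`: Leray's global weak solution `u_L` from `u₀` (`leray_existence_R3_holds`)
   agrees a.e. with `w` at every `t ∈ (0, T)` (Serrin weak–strong uniqueness), so `w`, completed at
   `t = T` by the slice `u_L T` (and at `t = 0` by `u₀`), is Leray–Hopf (`congr_ae_slices` and the
   time-zero update proved here).
5. Maximality: a classical extension past `T` is continuous, hence bounded, on the compact closure of
   a cylinder `Q_r(T, x_*)`, where it represents `u_K` a.e. — against the singular point.

## References

* T. Tao, J. Amer. Math. Soc. 29 (2016), arXiv:1402.0290v3, §1.1 (1.5), (1.15). [Tao2016AveragedNS]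
* P. G. Lemarié-Rieusset, *The Navier–Stokes problem in the 21st century*, Thm. 15.1, Prop. 12.3.
* W. Rusin, V. Šverák, J. Funct. Anal. 260 (2011) = arXiv:0911.0500, §4. [RusinSverak2011]
* T. Kato, Math. Z. 187 (1984), Thms. 1, 4. [Kato1984]
-/

section Part6

open _root_.MeasureTheory _root_.Set _root_.Filter _root_.Topology FourierTransform _root_.Function
open scoped _root_.ENNReal _root_.NNReal RealInnerProductSpace SchwartzMap _root_.ContDiff

-- the nested summit namespace `…NavierStokesRegularity.NavierStokesRegularity…` is the tree's layout
namespace Literature.Analysis.PerpetualPump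

open Literature.Analysis.FluidPDE Literature.Analysis.FluidPDE.Tao2016
open Literature.Analysis.FunctionSpaces (eFourierSobolevNorm)
open Literature.Analysis.FunctionSpaces.EuclideanSpace (complexify complexify_apply norm_complexify
  continuous_complexify)

namespace PumpContinuationMildBlowupClassical

/-! ## Small helpers -/

/-- A Schwartz field decays rapidly with all derivatives (Fefferman's class (4)). [folklore]
[cite: Tao2016AveragedNS, §1.1 (1.5), (1.15) (mild-maximal ⇒ classical blow-up; with Lemarié-Rieusset 2002 Thm. 15.1 / Rusin–Šverák 2011 §4 for the singular time) (source of the NOTION / ARGUMENT this module implements; this declaration is the cell’s own lemma or plumbing, NOT a printed statement)] -/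
theorem hasRapidSpatialDecay_schwartz (u₀ : 𝓢(EuclideanSpace ℝ (Fin 3), EuclideanSpace ℝ (Fin 3))) :
    HasRapidSpatialDecay (⇑u₀) := fun n K =>
  ⟨_, fun x =>
    SchwartzMap.one_add_le_sup_seminorm_apply (𝕜 := ℝ) (m := (K, n)) le_rfl le_rfl u₀ x⟩

/-- **A Leray–Hopf solution may be reset to its datum at `t = 0`** (unforced system, `T > 0`,
`u₀ ∈ L²`): every clause of `IsLerayHopfOn` lives on `(0, T]` except `u 0 ∈ L²` and the energy
inequality from `0` at `t = 0`, both of which hold for the slice `u₀`. [folklore]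
[cite: Tao2016AveragedNS, §1.1 (1.5), (1.15) (mild-maximal ⇒ classical blow-up; with Lemarié-Rieusset 2002 Thm. 15.1 / Rusin–Šverák 2011 §4 for the singular time) (source of the NOTION / ARGUMENT this module implements; this declaration is the cell’s own lemma or plumbing, NOT a printed statement)] -/
theorem isLerayHopfOn_update_zero {T ν : ℝ} {u₀ : EuclideanSpace ℝ (Fin 3) → EuclideanSpace ℝ (Fin 3)}
    {u : ℝ → EuclideanSpace ℝ (Fin 3) → EuclideanSpace ℝ (Fin 3)}
    (h : IsLerayHopfOn T ν 0 u₀ u) (hu₀ : MemLp u₀ 2 volume) :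
    IsLerayHopfOn T ν 0 u₀ (update u 0 u₀) := by
  have hne : ∀ {t : ℝ}, 0 < t → update u 0 u₀ t = u t := fun ht => update_of_ne ht.ne' _ _
  -- the weak formulation only sees `(0, T)`
  have hweak : IsWeakNSSolutionOn T ν 0 u₀ (update u 0 u₀) := by
    refine IsWeakNSSolutionOn.congr_ae_slice h.weak ?_
    filter_upwards [ae_restrict_mem measurableSet_Ioo] with t ht
    exact hne ht.1
  -- `L^∞(0, T; L²)`
  have hEB : ∃ C : ℝ≥0, ∀ᵐ t ∂(volume.restrict (Ioo 0 T)), eEnergy (update u 0 u₀ t) ≤ C := by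
    obtain ⟨C, hC⟩ := h.energy_bound
    refine ⟨C, ?_⟩
    filter_upwards [hC, ae_restrict_mem measurableSet_Ioo] with t ht htI
    rwa [hne htI.1]
  -- slices in `L²`
  have hmem : ∀ t ∈ Icc 0 T, MemLp (update u 0 u₀ t) 2 volume := by
    intro t ht
    rcases ht.1.eq_or_lt with h0 | ht0
    · rw [← h0, update_self]; exact hu₀
    · rw [hne ht0]; exact h.memLp t ht
  -- weak gradient and the energy inequalities
  have hWG : ∃ G : ℝ → EuclideanSpace ℝ (Fin 3) →
      EuclideanSpace ℝ (Fin 3) →L[ℝ] EuclideanSpace ℝ (Fin 3),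
      (∀ᵐ t ∂(volume.restrict (Ioo 0 T)), HasWeakGradient (update u 0 u₀ t) (G t)) ∧
      (∫⁻ t in Ioo 0 T, ∫⁻ x, ENNReal.ofReal (frobeniusNormSq (G t x)) < (⊤ : ℝ≥0∞)) ∧
      (∀ t ∈ Icc 0 T, VectorCalculus.kineticEnergy (update u 0 u₀ t) +
        ν * (∫⁻ τ in Ioo 0 t, ∫⁻ x, ENNReal.ofReal (frobeniusNormSq (G τ x))).toReal ≤
        VectorCalculus.kineticEnergy u₀ +
          ∫ τ in (0 : ℝ)..t, ∫ x,
            ⟪(0 : ℝ → EuclideanSpace ℝ (Fin 3) → EuclideanSpace ℝ (Fin 3)) τ x, update u 0 u₀ τ x⟫) ∧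
      (∀ᵐ s ∂(volume.restrict (Ioo 0 T)), ∀ t ∈ Icc s T,
        VectorCalculus.kineticEnergy (update u 0 u₀ t) +
          ν * (∫⁻ τ in Ioo s t, ∫⁻ x, ENNReal.ofReal (frobeniusNormSq (G τ x))).toReal ≤
        VectorCalculus.kineticEnergy (update u 0 u₀ s) +
          ∫ τ in s..t, ∫ x,
            ⟪(0 : ℝ → EuclideanSpace ℝ (Fin 3) → EuclideanSpace ℝ (Fin 3)) τ x, update u 0 u₀ τ x⟫) := by
    obtain ⟨G, hG, hGint, h0, hae⟩ := h.weakGrad_energy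
    refine ⟨G, ?_, hGint, fun t ht => ?_, ?_⟩
    · filter_upwards [hG, ae_restrict_mem measurableSet_Ioo] with t ht htI
      rwa [hne htI.1]
    · rcases ht.1.eq_or_lt with h00 | ht0
      · subst h00
        simp only [update_self, Ioo_self, Measure.restrict_empty, lintegral_zero_measure,
          ENNReal.toReal_zero, mul_zero, add_zero, intervalIntegral.integral_same, le_refl]
      · have h1 := h0 t ht
        simp only [Pi.zero_apply, inner_zero_left, integral_zero, intervalIntegral.integral_zero,
          add_zero] at h1 ⊢
        rwa [hne ht0]
    · filter_upwards [hae, ae_restrict_mem measurableSet_Ioo] with s hs hsI t hst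
      have h1 := hs t hst
      simp only [Pi.zero_apply, inner_zero_left, integral_zero, intervalIntegral.integral_zero,
        add_zero] at h1 ⊢
      rwa [hne (hsI.1.trans_le hst.1), hne hsI.1]
  -- weak `L²` continuity and the weak initial limit
  have hWC : ∀ w : EuclideanSpace ℝ (Fin 3) → EuclideanSpace ℝ (Fin 3), MemLp w 2 volume →
      ContinuousOn (fun t => ∫ x, ⟪update u 0 u₀ t x, w x⟫) (Ioc 0 T) ∧
        Tendsto (fun t => ∫ x, ⟪update u 0 u₀ t x, w x⟫) (𝓝[>] 0) (𝓝 (∫ x, ⟪u₀ x, w x⟫)) := by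
    intro w hw
    obtain ⟨hcont, hlim⟩ := h.weak_continuous w hw
    refine ⟨hcont.congr fun t ht => by simp only [hne ht.1], hlim.congr' ?_⟩
    filter_upwards [self_mem_nhdsWithin] with t ht
    simp only [hne (show 0 < t from ht)]
  -- strong attainment of the datum
  have hSI : Tendsto (fun t => eLpNorm (update u 0 u₀ t - u₀) 2 volume) (𝓝[>] 0) (𝓝 0) := by
    refine h.strong_initial.congr' ?_
    filter_upwards [self_mem_nhdsWithin] with t ht
    simp only [hne (show 0 < t from ht)]
  exact ⟨hweak, hEB, hmem, hWG, hWC, hSI⟩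

/-- **Classical Leray–Hopf solutions from a Schwartz datum are `H¹⁰_df`-mild (Tao (1.5), `ν = 1`).**
The complexified curve `U t = [(u t)^ℂ]` of a classical solution on `[0, T)`, Leray–Hopf from the
Schwartz datum `u₀ = u 0`, is an `H¹⁰_df`-mild solution of Tao's identity for the Euler form with
datum `schwartzL2 u₀` — the proved front end of `EulerTypeIGlue` (`stub_memH10`, `stub_continuity`,
`stub_identityTests`, `stub_cubic`, `stub_testToH10`) at unit viscosity.
[cite: Tao2016AveragedNS, §1.1 (1.5), (1.15)] -/
theorem exists_isMildSolutionFor_of_classical {T : ℝ} (hT : 0 < T)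
    (u₀ : 𝓢(EuclideanSpace ℝ (Fin 3), EuclideanSpace ℝ (Fin 3)))
    {u : ℝ → EuclideanSpace ℝ (Fin 3) → EuclideanSpace ℝ (Fin 3)} {p : ℝ → EuclideanSpace ℝ (Fin 3) → ℝ}
    (hcl : IsClassicalNSSolutionOn (Ico 0 T) 1 0 u p)
    (hLH : IsLerayHopfOn T 1 0 (⇑u₀) u) (hu0 : u 0 = ⇑u₀) :
    ∃ U : ℝ → L2C, IsMildSolutionFor eulerForm (schwartzL2 u₀) (Ico 0 T) U ∧
      ∀ t ∈ Ico 0 T,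
        ((U t : L2C) : EuclideanSpace ℝ (Fin 3) → EuclideanSpace ℂ (Fin 3)) =ᵐ[volume] complexify ∘ u t := by
  have hLH' : IsLerayHopfOn T 1 0 (u 0) u := by rwa [hu0]
  have hdec : HasRapidSpatialDecay (u 0) := hu0 ▸ hasRapidSpatialDecay_schwartz u₀
  have h2 : ∀ t ∈ Ico 0 T, MemLp (complexify ∘ u t) 2 (volume : Measure (EuclideanSpace ℝ (Fin 3))) :=
    fun t ht =>
    PerpetualPumpEulerTypeIGlue.memLp_complexify_of_memLp (hLH.memLp t ⟨ht.1, ht.2.le⟩)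
  classical
  let U : ℝ → L2C := fun t => if ht : t ∈ Ico 0 T then (h2 t ht).toLp _ else 0
  have hU_eq : ∀ t (ht : t ∈ Ico 0 T), U t = (h2 t ht).toLp _ := fun t ht => by
    simp only [U, dif_pos ht]
  have hU : ∀ t ∈ Ico 0 T,
      ((U t : L2C) : EuclideanSpace ℝ (Fin 3) → EuclideanSpace ℂ (Fin 3)) =ᵐ[volume] complexify ∘ u t :=
      fun t ht => by
    rw [hU_eq t ht]
    exact (h2 t ht).coeFn_toLp
  have h0T : (0 : ℝ) ∈ Ico 0 T := ⟨le_rfl, hT⟩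
  have hH : ∀ t ∈ Ico 0 T, MemH10df (U t) :=
    PerpetualPumpEulerTypeIGlue.stub_memH10 one_pos hcl hLH' hdec U hU
  have hc : ContinuousInH10On (Ico 0 T) U :=
    PerpetualPumpEulerTypeIGlue.stub_continuity one_pos hT hcl hLH' hdec U hU
  have hid := PerpetualPumpEulerTypeIGlue.stub_testToH10 U hH hc
    (PerpetualPumpEulerTypeIGlue.stub_identityTests one_pos hT hcl hLH' hdec U hU hH
      (fun hf h2 hH hdf hψ hψ1 hψ' hψ2 =>
        PerpetualPumpEulerTypeIGlue.stub_cubic hf h2 hH hdf hψ hψ1 hψ' hψ2))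
  have hU0 : U 0 = schwartzL2 u₀ := by
    rw [hU_eq 0 h0T]
    exact MemLp.toLp_congr _ _ (Eventually.of_forall fun x => by rw [hu0])
  refine ⟨U, ⟨hH, hc, fun t ht w hw => ?_⟩, hU⟩
  have h := hid t ht w hw
  simp only [one_mul] at h
  rwa [hU0] at h

/-- **Bounded fields are in the Serrin class `L^∞_t L^∞_x`**, for a Tao-class solution. [folklore]
[cite: Tao2016AveragedNS, §1.1 (1.5), (1.15) (mild-maximal ⇒ classical blow-up; with Lemarié-Rieusset 2002 Thm. 15.1 / Rusin–Šverák 2011 §4 for the singular time) (source of the NOTION / ARGUMENT this module implements; this declaration is the cell’s own lemma or plumbing, NOT a printed statement)] -/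
theorem memLqLp_top_top_of_isTaoSolutionOn {T : ℝ} {a : EuclideanSpace ℝ (Fin 3) → EuclideanSpace ℝ (Fin 3)}
    {v : ℝ → EuclideanSpace ℝ (Fin 3) → EuclideanSpace ℝ (Fin 3)} {q : ℝ → EuclideanSpace ℝ (Fin 3) → ℝ}
    (hv : IsTaoSolutionOn T 1 a v q) : MemLqLp ⊤ ⊤ v (Ioo 0 T) := by
  obtain ⟨B, hB0, hB⟩ := hv.exists_bound_velocity
  exact memLqLp_top_top_of_forall_norm_le measurableSet_Ioo hB0
    (fun t ht => (hv.classical.contDiff_velocity ⟨ht.1.le, ht.2.le⟩).continuous)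
    fun t ht x => hB t ⟨ht.1.le, ht.2.le⟩ x

end PumpContinuationMildBlowupClassical

open PumpContinuationMildBlowupClassical in
/-- **`MildBlowupClassical` (stmt-NavierStokesRegularity-18304) holds**: an `H¹⁰_df`-mild solution of
the Navier–Stokes form (Tao (1.5), `ν = 1`) from a Schwartz divergence-free datum with no mild
extension past `S` yields a maximal smooth solution with finite lifespan, Leray–Hopf from its rapidly
decaying datum (X5a). The lifespan is the Kato maximal time `T_max(u₀)`, finite because a global Kato
solution would be classical (von Wahl / Lemarié-Rieusset Prop. 12.3), hence `H¹⁰_df`-mild past `S`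
(front end of `EulerTypeIGlue` + uniqueness of `H¹⁰_df`-mild solutions); the solution is the glued
family of Tao-class solutions below `T_max`, Leray–Hopf by comparison with Leray's weak solution, and
maximal because of the singular point at `T_max` (Lemarié-Rieusset Thm. 15.1 / Rusin–Šverák §4).
[cite: Tao2016AveragedNS, §1.1 (1.5), (1.15)] -/
theorem pumpContinuation_mildBlowupClassical_proof :
    Literature.Analysis.FluidPDE.FluidComputer.MildMaximalGivesBlowup := by
  intro u₀ hdiv S hS u hu hnoext
  classical
  -- the datum
  have hsm : ContDiff ℝ ∞ (⇑u₀) := u₀.smooth ⊤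
  have hdec : HasRapidSpatialDecay (⇑u₀) := hasRapidSpatialDecay_schwartz u₀
  have hdivW : NSWave0.IsDivFree (⇑u₀) := fun x => hdiv x
  have h2 : MemLp (⇑u₀) 2 (volume : Measure (EuclideanSpace ℝ (Fin 3))) := u₀.memLp 2 _
  have h3 : MemLp (⇑u₀) 3 (volume : Measure (EuclideanSpace ℝ (Fin 3))) := u₀.memLp 3 _
  have hwdiv : IsWeaklyDivFree (⇑u₀) :=
    VectorCalculus.IsDivFree.isWeaklyDivFree_holds hdiv (hsm.of_le (mod_cast le_top))
  /- Step 1: `u₀` has no global Kato solution (else a mild extension of `u` past `S`). -/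
  have hng : ¬ HasGlobalKatoSolution 1 (⇑u₀) := by
    intro hK
    have hS1 : 0 < S + 1 := by linarith
    obtain ⟨v, q, hv⟩ :=
      exists_isTaoSolutionOn_of_hasGlobalKatoSolution' one_pos hsm hdivW hdec hK hS1
    have hcl : IsClassicalNSSolutionOn (Ico 0 (S + 1)) 1 0 v q :=
      hv.classical.mono Ico_subset_Icc_self (uniqueDiffOn_Ico 0 (S + 1))
    obtain ⟨V, hV, -⟩ :=
      exists_isMildSolutionFor_of_classical hS1 u₀ hcl (hv.isLerayHopfOn hS1) hv.initial
    refine hnoext ⟨S + 1, by linarith, V, hV, fun t ht => ?_⟩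
    have hV' : IsMildSolutionFor AveragingDatum.euler.form (schwartzL2 u₀) (Ico 0 S) V := by
      rw [Literature.Barriers.NavierStokesRegularity.AveragedTypeI.euler_form_eq]
      exact hV.mono (Ico_subset_Ico_right (by linarith))
    have hu' : IsMildSolutionFor AveragingDatum.euler.form (schwartzL2 u₀) (Ico 0 S) u := by
      rw [Literature.Barriers.NavierStokesRegularity.AveragedTypeI.euler_form_eq]
      exact hu
    exact PerpetualPumpThesis.stub_uniqueness AveragingDatum.euler (schwartzL2 u₀) S V u hV' hu' t
      ht
  /- Step 2: the maximal Kato solution `uK` on `[0, T)`, `T = T_max(u₀) < ∞`, and its singular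
  point. -/
  obtain ⟨hpos, htop, xs, uK, huK, hsing⟩ := exists_singularPoint_katoMaximalTime kato_local_holds
    IsKatoSolutionOn.continuation_of_bounded_holds IsKatoSolutionOn.farField_bound_holds one_pos h3
    hwdiv hng
  set T : ℝ := (katoMaximalTime 1 (⇑u₀)).toReal with hTdef
  have hT : 0 < T := ENNReal.toReal_pos hpos.ne' htop.ne
  /- Step 3: Tao-class solutions on `[0, b n]`, `b n ↑ T`, glued to a classical solution on
  `[0, T)`. -/
  set b : ℕ → ℝ := fun n => T - T / ((n : ℝ) + 2) with hbdef
  have hb_pos : ∀ n, 0 < b n := fun n => by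
    have hn2 : (2 : ℝ) ≤ (n : ℝ) + 2 := by have := n.cast_nonneg (α := ℝ); linarith
    have h1 : T / ((n : ℝ) + 2) ≤ T / 2 := div_le_div_of_nonneg_left hT.le (by norm_num) hn2
    show 0 < T - T / ((n : ℝ) + 2)
    linarith
  have hb_lt : ∀ n, b n < T := fun n => by
    have : 0 < T / ((n : ℝ) + 2) := by positivity
    show T - T / ((n : ℝ) + 2) < T
    linarith
  have hcof : ∀ t, t < T → ∃ n, t < b n := by
    intro t ht
    obtain ⟨n, hn⟩ := exists_nat_gt (T / (T - t))
    refine ⟨n, ?_⟩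
    have hpos' : 0 < T - t := sub_pos.2 ht
    rw [div_lt_iff₀ hpos'] at hn
    have h1 : T < ((n : ℝ) + 2) * (T - t) := by nlinarith
    have h2 : T / ((n : ℝ) + 2) < T - t := by
      rw [div_lt_iff₀ (by positivity)]
      linarith [mul_comm (T - t) ((n : ℝ) + 2)]
    show t < T - T / ((n : ℝ) + 2)
    linarith
  have hex : ∀ n, ∃ (U : ℝ → EuclideanSpace ℝ (Fin 3) → EuclideanSpace ℝ (Fin 3))
      (P : ℝ → EuclideanSpace ℝ (Fin 3) → ℝ), IsTaoSolutionOn (b n) 1 (⇑u₀) U P := fun n =>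
    exists_isTaoSolutionOn_of_isKatoSolutionOn one_pos hsm hdivW hdec huK (hb_pos n) (hb_lt n)
  choose U P hUP using hex
  have hagree : ∀ m n, ∀ t ∈ Ico 0 (min (b m) (b n)), U m t = U n t := fun m n =>
    (hUP m).eq_of_isTaoSolutionOn (hUP n) one_pos (hb_pos m) (hb_pos n)
  obtain ⟨w, p, hwcl, hwU⟩ := IsClassicalNSSolutionOn.exists_glue_Ico_right (a := 0) (β := T)
    (fun n => (hb_lt n).le) hcof
    (fun n => (hUP n).classical.mono Ico_subset_Icc_self (uniqueDiffOn_Ico 0 (b n))) hagree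
  -- `w` attains the datum and agrees a.e. slicewise with the Kato solution
  have hw0 : w 0 = ⇑u₀ := by
    rw [hwU 0 0 ⟨le_rfl, hb_pos 0⟩]; exact (hUP 0).initial
  have hwK : ∀ t ∈ Ico 0 T, w t =ᵐ[volume] uK t := by
    intro t ht
    obtain ⟨n, hn⟩ := hcof t ht.2
    have hKn := huK.mono (hb_lt n).le
    rw [hwU n t ⟨ht.1, hn⟩]
    exact (hUP n).ae_eq_of_kato one_pos hKn.mild hKn.continuousInLpOn hKn.aestronglyMeasurable t
      ⟨ht.1, hn⟩
  have hwmeas : AEStronglyMeasurable (uncurry w) (volume.restrict (Ioo 0 T ×ˢ univ)) :=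
    (hwcl.smooth_velocity.continuousOn.mono
      (prod_mono Ioo_subset_Ico_self Subset.rfl)).aestronglyMeasurable
        (measurableSet_Ioo.prod MeasurableSet.univ)
  /- Step 4: Leray–Hopf on `[0, T]` by comparison with Leray's global weak solution. -/
  obtain ⟨uL, huL⟩ := leray_existence_R3_holds 1 one_pos (⇑u₀) h2 hwdiv
  have hLw : ∀ t ∈ Ioo 0 T, w t =ᵐ[volume] uL t := by
    intro t ht
    obtain ⟨n, hn⟩ := hcof t ht.2
    have hae := serrin_weak_strong_uniqueness_holds one_pos (hb_pos n)
      ((hUP n).isLerayHopfOn (hb_pos n)) h2 (q := ⊤) (r := ⊤) (by simp) (by simp)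
      (memLqLp_top_top_of_isTaoSolutionOn (hUP n)) (huL (b n) (hb_pos n)) t ⟨ht.1, hn.le⟩
    rw [hwU n t ⟨ht.1.le, hn⟩]
    exact hae.symm
  -- the completed velocity: `w` on `[0, T)`, Leray's slice at `t = T`
  set v₁ : ℝ → EuclideanSpace ℝ (Fin 3) → EuclideanSpace ℝ (Fin 3) :=
    fun t => if t ∈ Ioo 0 T then w t else uL t with hv₁_def
  set wf : ℝ → EuclideanSpace ℝ (Fin 3) → EuclideanSpace ℝ (Fin 3) := update v₁ 0 (⇑u₀)
    with hwf_def
  have hwf0 : wf 0 = ⇑u₀ := by rw [hwf_def, update_self]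
  have hwf : ∀ t ∈ Ico 0 T, wf t = w t := by
    intro t ht
    rcases ht.1.eq_or_lt with h0 | ht0
    · rw [← h0, hwf0, hw0]
    · rw [hwf_def, update_of_ne ht0.ne', show v₁ t = w t from if_pos ⟨ht0, ht.2⟩]
  have hv₁meas : AEStronglyMeasurable (uncurry v₁) (volume.restrict (Ioo 0 T ×ˢ univ)) := by
    refine hwmeas.congr ?_
    filter_upwards [ae_restrict_mem (measurableSet_Ioo.prod MeasurableSet.univ)] with z hz
    show w z.1 z.2 = v₁ z.1 z.2
    rw [show v₁ z.1 = w z.1 from if_pos hz.1]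
  have hLH₁ : IsLerayHopfOn T 1 0 (⇑u₀) v₁ := by
    refine (huL T hT).congr_ae_slices hT hv₁meas fun t ht => ?_
    by_cases htI : t ∈ Ioo 0 T
    · rw [show v₁ t = w t from if_pos htI]
      exact hLw t htI
    · rw [show v₁ t = uL t from if_neg htI]
  have hLH : IsLerayHopfOn T 1 0 (⇑u₀) wf := by
    rw [hwf_def]
    exact isLerayHopfOn_update_zero hLH₁ h2
  have hwfcl : IsClassicalNSSolutionOn (Ico 0 T) 1 0 wf p := hwcl.congr_slices hwf fun _ _ => rfl
  /- Step 5: maximality from the singular point `(T, xs)`. -/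
  have hmax : ¬ HasSmoothExtensionPast 1 0 wf T := by
    rintro ⟨T', hTT', u', p', hcl', hagree'⟩
    -- a backward cylinder inside the strip `(0, T) × (EuclideanSpace ℝ (Fin 3))`
    set r : ℝ := min 1 (T / 2) with hr
    have hr0 : 0 < r := lt_min one_pos (by linarith)
    have hrT : r ^ 2 < T := by
      have h1 : r ≤ 1 := min_le_left _ _
      have h2 : r ≤ T / 2 := min_le_right _ _
      nlinarith
    -- the extension is bounded on the compact closure of the cylinder
    have hK : IsCompact (Icc (T - r ^ 2) T ×ˢ Metric.closedBall xs r) :=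
      isCompact_Icc.prod (isCompact_closedBall _ _)
    have hKsub : Icc (T - r ^ 2) T ×ˢ Metric.closedBall xs r ⊆
        Ico 0 T' ×ˢ (univ : Set (EuclideanSpace ℝ (Fin 3))) :=
      prod_mono (fun t ht => ⟨by linarith [ht.1, sq_nonneg r], ht.2.trans_lt hTT'⟩) (subset_univ _)
    obtain ⟨M, hM⟩ :=
      hK.exists_bound_of_continuousOn (hcl'.smooth_velocity.continuousOn.mono hKsub)
    -- `uK = w = u'` a.e. on the cylinder
    have haeK : uncurry uK =ᵐ[volume.restrict (Ioo 0 T ×ˢ univ)] uncurry w :=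
      ae_restrict_prod_of_forall_ae_eq (fun t ht => (hwK t ⟨ht.1.le, ht.2⟩).symm)
        huK.aestronglyMeasurable hwmeas
    have hQsub :
        parabolicCylinder r (T, xs) ⊆ Ioo 0 T ×ˢ (univ : Set (EuclideanSpace ℝ (Fin 3))) := by
      intro z hz
      simp only [mem_parabolicCylinder] at hz
      exact ⟨⟨by linarith [hz.1.1], hz.1.2⟩, mem_univ _⟩
    have hQmeas : MeasurableSet (parabolicCylinder r ((T, xs) : ℝ × EuclideanSpace ℝ (Fin 3))) :=
      measurableSet_Ioo.prod Metric.isOpen_ball.measurableSet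
    have hbd : ∀ᵐ z ∂(volume.restrict (parabolicCylinder r (T, xs))), ‖uncurry uK z‖ ≤ M := by
      filter_upwards [ae_restrict_of_ae_restrict_of_subset hQsub haeK, ae_restrict_mem hQmeas]
        with z hz hzQ
      simp only [mem_parabolicCylinder] at hzQ
      have hzT : z.1 ∈ Ico 0 T := ⟨by linarith [hzQ.1.1], hzQ.1.2⟩
      rw [hz, show uncurry w z = u' z.1 z.2 by
        show w z.1 z.2 = u' z.1 z.2
        rw [hagree' z.1 hzT, hwf z.1 hzT]]
      exact hM z ⟨⟨hzQ.1.1.le, hzQ.1.2.le⟩, Metric.mem_closedBall.2 hzQ.2.le⟩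
    have hfin : eLpNorm (uncurry uK) ⊤ (volume.restrict (parabolicCylinder r (T, xs))) < ⊤ := by
      rw [eLpNorm_exponent_top]
      exact eLpNormEssSup_lt_top_of_ae_bound hbd
    exact hfin.ne (hsing r hr0)
  refine ⟨T, hT, wf, p, ⟨hwfcl, hmax⟩, ?_, ?_⟩
  · rw [hwf0]; exact hLH
  · rw [hwf0]; exact hdec

end Literature.Analysis.PerpetualPump

end Part6

/-! ## Part 7 — the EXACT discharge -/

namespace Literature.Analysis.FluidPDE.FluidComputer

/-- **The named fact `MildMaximalGivesBlowup` HOLDS** (`FluidComputer/CascadeWitness.lean`; Tao 2016 §1.1: mild-maximal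
`H¹⁰_df` solutions of the true Navier–Stokes form from Schwartz divergence-free data give a maximal smooth solution with finite
lifespan, Leray–Hopf from its rapidly decaying datum).  EXACT-name alias of
`PerpetualPump.pumpContinuation_mildBlowupClassical_proof` (this file), Literature-side twin of
`Summit.NavierStokesRegularity.NavierStokesRegularity.Theorems.FluidComputer.mildMaximalGivesBlowup_holds`
(`FluidComputerCascade.lean`, same term). [cite: Tao2016AveragedNS, §1.1 (1.5), (1.15)] -/
theorem MildMaximalGivesBlowup_holds : MildMaximalGivesBlowup :=
  PerpetualPump.pumpContinuation_mildBlowupClassical_proof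

end Literature.Analysis.FluidPDE.FluidComputer

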